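import Literature.NumberTheory.LFunctions.LatticePieceScale
import HarnessLib

/-!
# The pieces of the Gaussian lattice sums: geometry of the sector trapezoids, the choice of the line
# direction, and the piece hypotheses for the logarithmic phase and its differences

Topic `Literature/NumberTheory/LFunctions`.  Everything here is PROVED; the definitions are the piece trapezoid
`VdC.pieceT u R = trap u R (4R) (1/9)`, the piece weight `VdC.pwt` (the smooth weight `VdC.wt` cut off by the
indicator of the trapezoid) and its differenced version `VdC.pwtH`.

For the phase `F = Im G`, `G = (w/2π) log(z ū)` (`Φ(z) = λ^m(z) N(z)^{-it} = e(F(z)) · const`, `w = 4m - 2ti`) on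
the trapezoid `T` of direction `u` and size `R`, and for its differences `F(z+h) - F(z)`, we choose a lattice
direction `d ∈ {1, i, 1+i, 1-i}` (`VdC.exists_direction`) making the second derivative along the lines positive,
verify all the hypotheses `VdC.PieceHyp` with constants in the scale form of `LatticePieceScale.lean`, and deduce
the piece bounds `VdC.norm_plainPiece_le`, `VdC.norm_diffPiece_le`.

## References

* E. C. Titchmarsh, *The lattice-points in a circle*, Proc. London Math. Soc. (2) 38 (1935), 96–115.
  [Titchmarsh1935Lattice]
* R. M. Kaufman, *An estimate of Hecke's `L`-functions of the Gaussian field on the line `Re s = 1/2`*, Zap.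
  Naučn. Sem. LOMI 91 (1979), 40–51. [Kaufman1979]
-/

noncomputable section

open Real Set Metric Classical

namespace Literature.NumberTheory.LFunctions
namespace VdC

/-! ### Trigonometric lemmas -/

/-- `|arg q| ≤ arctan t` when `Re q > 0` and `|Im q| ≤ t Re q`. [folklore] -/
theorem abs_arg_le_arctan {q : ℂ} {t : ℝ} (hq : 0 < q.re) (h : |q.im| ≤ t * q.re) :
    |Complex.arg q| ≤ Real.arctan t := by
  have harg : |Complex.arg q| < π / 2 := Complex.abs_arg_lt_pi_div_two_iff.2 (Or.inl hq)
  rw [abs_lt] at harg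
  have htan : Real.tan (Complex.arg q) = q.im / q.re := Complex.tan_arg q
  have h1 : |q.im / q.re| ≤ t := by
    rw [abs_div, abs_of_pos hq, div_le_iff₀ hq]; exact h
  have h2 : Complex.arg q = Real.arctan (q.im / q.re) := by
    rw [← htan, Real.arctan_tan harg.1 harg.2]
  rw [h2]
  rw [abs_le] at h1 ⊢
  constructor
  · have := Real.arctan_strictMono.monotone h1.1
    rw [Real.arctan_neg] at this
    exact this
  · exact Real.arctan_strictMono.monotone h1.2

/-- `arctan(1/8) < π/24`. [folklore] -/
theorem arctan_one_eighth_lt : Real.arctan (1 / 8) < π / 24 := by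
  have hπ := Real.pi_gt_d2
  have h1 : (1 / 8 : ℝ) < π / 24 := by linarith
  have h2 : π / 24 < π / 2 := by linarith [Real.pi_pos]
  have h3 : π / 24 < Real.tan (π / 24) := Real.lt_tan (by positivity) h2
  -- `arctan` is the inverse of `tan` on `(-π/2, π/2)` and `tan` is increasing there
  have h4 : Real.tan (Real.arctan (1 / 8)) < Real.tan (π / 24) := by rw [Real.tan_arctan]; linarith
  by_contra hcon
  push Not at hcon
  have hmono := Real.strictMonoOn_tan
  have ha : Real.arctan (1 / 8) ∈ Ioo (-(π / 2)) (π / 2) := ⟨Real.neg_pi_div_two_lt_arctan _, Real.arctan_lt_pi_div_two _⟩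
  have hb : π / 24 ∈ Ioo (-(π / 2)) (π / 2) := ⟨by linarith [Real.pi_pos], h2⟩
  have := hmono.le_iff_le hb ha |>.2 hcon
  linarith

/-- If `|a| ≤ π/24` and `cos(24a) > -1/2` then `|a| < π/36`. [folklore] -/
theorem abs_lt_of_cos24 {a : ℝ} (ha : |a| ≤ π / 24) (hc : -(1 / 2) < Real.cos (24 * a)) : |a| < π / 36 := by
  by_contra hcon
  push Not at hcon
  have hπ := Real.pi_pos
  have h1 : Real.cos (24 * a) = Real.cos (24 * |a|) := by
    rcases abs_choice a with h | h
    · rw [h]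
    · rw [h, mul_neg, Real.cos_neg]
  have h2 : 2 * π / 3 ≤ 24 * |a| := by linarith
  have h3 : 24 * |a| ≤ π := by linarith
  have h4 : Real.cos (24 * |a|) ≤ Real.cos (2 * π / 3) :=
    Real.cos_le_cos_of_nonneg_of_le_pi (by positivity) h3 h2
  have h5 : Real.cos (2 * π / 3) = -(1 / 2) := by
    rw [show 2 * π / 3 = π - π / 3 by ring, Real.cos_pi_sub, Real.cos_pi_div_three]
  linarith

/-- For `|a| < π/36`: `cos a ≥ 99/100` and `|sin a| ≤ 9/100`. [folklore] -/
theorem cos_sin_small {a : ℝ} (ha : |a| < π / 36) : 99 / 100 ≤ Real.cos a ∧ |Real.sin a| ≤ 9 / 100 := by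
  have hπ := Real.pi_lt_d2
  have ha' : |a| < 9 / 100 := by linarith
  constructor
  · have h := Real.one_sub_sq_div_two_le_cos (x := a)
    have : a ^ 2 ≤ (9 / 100) ^ 2 := by
      rw [← sq_abs]; exact pow_le_pow_left₀ (abs_nonneg a) ha'.le 2
    linarith
  · exact Real.abs_sin_le_abs.trans ha'.le

/-- `sin(π/8) ≥ 3/8`. [folklore] -/
theorem three_eighths_le_sin : (3 / 8 : ℝ) ≤ Real.sin (π / 8) := by
  have hπ := Real.pi_gt_d6
  have hπ' := Real.pi_lt_d2
  have h1 : (0 : ℝ) < π / 8 := by positivity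
  have h := Real.sin_gt_sub_cube h1
  have h3 : (π / 8) ^ 3 ≤ (315 / 800) ^ 3 := pow_le_pow_left₀ h1.le (by linarith) 3
  nlinarith

/-- `sin y ≥ sin(π/8) ≥ 3/8` for `y ∈ [π/8, 7π/8]`. [folklore] -/
theorem sin_ge_on_arc {y : ℝ} (h1 : π / 8 ≤ y) (h2 : y ≤ 7 * π / 8) : (3 / 8 : ℝ) ≤ Real.sin y := by
  have hπ := Real.pi_pos
  refine three_eighths_le_sin.trans ?_
  rcases le_or_gt y (π / 2) with h | h
  · exact Real.sin_le_sin_of_le_of_le_pi_div_two (by linarith) h h1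
  · rw [← Real.sin_pi_sub y]
    exact Real.sin_le_sin_of_le_of_le_pi_div_two (by linarith) (by linarith) (by linarith)

/-- `sin` is `≥ 3/8` on `[π/8, 7π/8] + 2πn`. [folklore] -/
theorem sin_ge_on_arc_int {y : ℝ} (n : ℤ) (h1 : π / 8 ≤ y - 2 * π * n) (h2 : y - 2 * π * n ≤ 7 * π / 8) :
    (3 / 8 : ℝ) ≤ Real.sin y := by
  have := sin_ge_on_arc h1 h2
  rwa [show y - 2 * π * n = y - n * (2 * π) by ring, Real.sin_sub_int_mul_two_pi] at this

/-! ### The choice of the direction -/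

/-- The four admissible values of `d²`, `d ∈ {1, i, 1+i, 1-i}`. [folklore] -/
def dirSq (k : Fin 4) : ℂ := ![1, -1, 2 * Complex.I, -(2 * Complex.I)] k

/-- The corresponding directions `d`. [folklore] -/
def dir (k : Fin 4) : ℂ := ![1, Complex.I, 1 + Complex.I, 1 - Complex.I] k

/-- `dir k ^ 2 = dirSq k`. [folklore] -/
theorem dir_sq (k : Fin 4) : dir k ^ 2 = dirSq k := by
  fin_cases k <;> simp [dir, dirSq, Complex.ext_iff, pow_two] <;> norm_num

/-- The argument `β_k` of `dirSq k`: `dirSq k = ‖dirSq k‖ e^{iβ_k}`, `β ∈ {0, π, π/2, -π/2}`. [folklore] -/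
def dirArg (k : Fin 4) : ℝ := ![0, π, π / 2, -(π / 2)] k

/-- `dirSq k = ‖dirSq k‖ exp(i β_k)` and `‖dirSq k‖ ∈ {1, 2}`, nonzero. [folklore] -/
theorem dirSq_polar (k : Fin 4) : dirSq k = (‖dirSq k‖ : ℂ) * Complex.exp (dirArg k * Complex.I) ∧ 0 < ‖dirSq k‖ := by
  fin_cases k
  · simp [dirSq, dirArg]
  · constructor
    · simp [dirSq, dirArg]
    · simp [dirSq]
  · constructor
    · simp [dirSq, dirArg, Complex.exp_mul_I, Complex.ofReal_div]
    · simp [dirSq]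
  · constructor
    · have : Complex.exp (-(↑π / 2 * Complex.I)) = -Complex.I := by
        rw [show -(↑π / 2 * Complex.I) = (-(π / 2 : ℝ) : ℂ) * Complex.I by push_cast; ring, Complex.exp_mul_I]
        push_cast
        rw [Complex.cos_neg, Complex.sin_neg, Complex.cos_pi_div_two, Complex.sin_pi_div_two]; ring
      simp [dirSq, dirArg, Complex.ofReal_div, Complex.ofReal_neg, this]
    · simp [dirSq]

/-- **The direction lemma.**  For every `ζ₀` there is `k` such that
`-Im(dirSq k · ζ₀ · e^{-ix}) ≥ (3/8) ‖dirSq k · ζ₀‖` for all `|x| ≤ π/8`. [folklore] -/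
theorem exists_direction (ζ₀ : ℂ) :
    ∃ k : Fin 4, ∀ x : ℝ, |x| ≤ π / 8 →
      (3 / 8 : ℝ) * ‖dirSq k * ζ₀‖ ≤ -(dirSq k * ζ₀ * Complex.exp (-(x : ℂ) * Complex.I)).im := by
  have hπ := Real.pi_pos
  set γ := Complex.arg ζ₀ with hγ
  have hγ1 : -π < γ := Complex.neg_pi_lt_arg ζ₀
  have hγ2 : γ ≤ π := Complex.arg_le_pi ζ₀
  have hζp : ζ₀ = (‖ζ₀‖ : ℂ) * Complex.exp (γ * Complex.I) := (Complex.norm_mul_exp_arg_mul_I ζ₀).symm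
  -- the general computation
  have key : ∀ k : Fin 4, ∀ x : ℝ,
      -(dirSq k * ζ₀ * Complex.exp (-(x : ℂ) * Complex.I)).im = ‖dirSq k * ζ₀‖ * Real.sin (x - γ - dirArg k) := by
    intro k x
    obtain ⟨hk, hk0⟩ := dirSq_polar k
    have e1 : dirSq k * ζ₀ * Complex.exp (-(x : ℂ) * Complex.I)
        = ((‖dirSq k‖ * ‖ζ₀‖ : ℝ) : ℂ) * Complex.exp (((dirArg k + γ - x : ℝ) : ℂ) * Complex.I) := by
      conv_lhs => rw [hk, hζp]
      push_cast
      rw [show ((dirArg k : ℂ) + γ - x) * Complex.I = dirArg k * Complex.I + γ * Complex.I + (-(x : ℂ) * Complex.I) by ring,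
        Complex.exp_add, Complex.exp_add]
      ring
    rw [e1, Complex.im_ofReal_mul, Complex.exp_ofReal_mul_I_im, norm_mul]
    rw [show x - γ - dirArg k = -(dirArg k + γ - x) by ring, Real.sin_neg]
    ring
  -- choose `k` according to `γ`
  have choose : ∃ k : Fin 4, ∃ n : ℤ, π / 4 ≤ -γ - dirArg k - 2 * π * n ∧ -γ - dirArg k - 2 * π * n ≤ 3 * π / 4 := by
    by_cases h1 : γ ≤ -(π / 4)
    · by_cases h0 : -(3 * π / 4) ≤ γ
      · exact ⟨0, 0, by simp [dirArg]; constructor <;> linarith⟩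
      · -- `γ ∈ (-π, -3π/4)`: `β = π/2`, `-γ - π/2 ∈ (π/4, π/2)`
        push Not at h0
        exact ⟨2, 0, by simp [dirArg]; constructor <;> linarith⟩
    · push Not at h1
      by_cases h2 : γ ≤ π / 4
      · -- `β = -π/2`
        exact ⟨3, 0, by simp [dirArg]; constructor <;> linarith⟩
      · push Not at h2
        by_cases h3 : γ ≤ 3 * π / 4
        · -- `β = π`: `-γ - π ∈ [-7π/4, -5π/4]`, shift by `n = -1`
          exact ⟨1, -1, by simp [dirArg]; constructor <;> linarith⟩
        · push Not at h3
          -- `γ ∈ (3π/4, π]`, `β = π/2`: `-γ - π/2 ∈ [-3π/2, -5π/4)`, `n = -1`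
          exact ⟨2, -1, by simp [dirArg]; constructor <;> linarith⟩
  obtain ⟨k, n, hn1, hn2⟩ := choose
  refine ⟨k, fun x hx => ?_⟩
  rw [key k x]
  rw [abs_le] at hx
  have hs : (3 / 8 : ℝ) ≤ Real.sin (x - γ - dirArg k) := by
    refine sin_ge_on_arc_int n ?_ ?_ <;> linarith
  have h0 : 0 ≤ ‖dirSq k * ζ₀‖ := norm_nonneg _
  nlinarith

/-! ### The piece trapezoid and the weights -/

/-- The piece trapezoid `T = trap u R (4R) (1/9)`. [folklore] -/
def pieceT (u : ℂ) (R : ℝ) : Set ℂ := trap u R (4 * R) (1 / 9)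

section PieceGeom

variable {u : ℂ} {R x : ℝ} (hu : ‖u‖ = 1) (hR : 0 < R)
include hu hR

/-- Points of `T` in polar terms: `R ≤ ‖z‖ ≤ 40R/9`. [folklore] -/
theorem norm_bounds_of_mem_pieceT {z : ℂ} (hz : z ∈ pieceT u R) : R ≤ ‖z‖ ∧ ‖z‖ ≤ 40 * R / 9 := by
  refine ⟨norm_ge_of_mem_trap hu hz, (norm_le_of_mem_trap hu hR (by norm_num) hz).trans (le_of_eq (by ring))⟩

/-- `T ⊆ wtDom u R`. [folklore] -/
theorem pieceT_subset_wtDom : pieceT u R ⊆ wtDom u R := by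
  intro z hz
  obtain ⟨h1, h2⟩ := norm_bounds_of_mem_pieceT hu hR hz
  refine ⟨trap_subset_halfPlane hR hz, ?_, ?_⟩
  · show R ^ 2 / 2 < ‖z‖ ^ 2; nlinarith
  · show ‖z‖ ^ 2 < 25 * R ^ 2; nlinarith

/-- `T ⊆ B(0, 9R/2)`. [folklore] -/
theorem pieceT_subset_closedBall : pieceT u R ⊆ closedBall (0 : ℂ) (9 * R / 2) := by
  intro z hz
  rw [mem_closedBall, dist_zero_right]
  linarith [(norm_bounds_of_mem_pieceT hu hR hz).2]

/-- For `z ∈ T` and `‖h‖ ≤ R/100`, `z + h ∈ wtDom u R`. [folklore] -/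
theorem add_mem_wtDom {z h : ℂ} (hz : z ∈ pieceT u R) (hh : ‖h‖ ≤ R / 100) : z + h ∈ wtDom u R := by
  obtain ⟨h1, h2⟩ := norm_bounds_of_mem_pieceT hu hR hz
  have hre : R ≤ (z * (starRingEnd ℂ) u).re := hz.1
  refine ⟨?_, ?_, ?_⟩
  · show 0 < ((z + h) * (starRingEnd ℂ) u).re
    rw [add_mul, Complex.add_re]
    have : |(h * (starRingEnd ℂ) u).re| ≤ ‖h‖ := (Complex.abs_re_le_norm _).trans (le_of_eq (norm_mul_conj_eq hu))
    have := neg_abs_le (h * (starRingEnd ℂ) u).re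
    linarith
  · show R ^ 2 / 2 < ‖z + h‖ ^ 2
    have h3 : R - R / 100 ≤ ‖z + h‖ := by
      have := norm_sub_norm_le z (z + h); rw [sub_add_cancel_left, norm_neg] at this; linarith
    nlinarith
  · show ‖z + h‖ ^ 2 < 25 * R ^ 2
    have h3 : ‖z + h‖ ≤ 40 * R / 9 + R / 100 := (norm_add_le _ _).trans (by linarith)
    have h4 : 0 ≤ ‖z + h‖ := norm_nonneg _
    nlinarith

omit hu hR in
/-- The angle of a point of the open cone `Re q > 0`, `|Im q| ≤ Re q/8` is `< π/24`. [folklore] -/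
theorem abs_arg_lt_of_cone {q : ℂ} (hre : 0 < q.re) (him : |q.im| ≤ 1 / 8 * q.re) : |Complex.arg q| < π / 24 :=
  (abs_arg_le_arctan hre him).trans_lt arctan_one_eighth_lt

omit hu hR in
/-- `angA u y = arg(y ū)`. [folklore] -/
theorem angA_eq_arg (u y : ℂ) : angA u y = Complex.arg (y * (starRingEnd ℂ) u) := by
  rw [angA, logPhase_two_pi, Complex.log_im]

/-- **Deep points.**  If `φ(y) ≠ 0` and `y` lies in the cone `Re(yū) > 0`, `|Im(yū)| ≤ Re(yū)/8`, then `y ∈ T` and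
`B(y, δ) ⊆ T` whenever `50δ ≤ R`. [folklore] -/
theorem deep_of_wt_ne_zero {y : ℂ} (hy : wt x R u y ≠ 0) (hre : 0 < (y * (starRingEnd ℂ) u).re)
    (him : |(y * (starRingEnd ℂ) u).im| ≤ 1 / 8 * (y * (starRingEnd ℂ) u).re) :
    y ∈ pieceT u R ∧ ∀ δ : ℝ, 0 < δ → 50 * δ ≤ R → ball y δ ⊆ pieceT u R := by
  set q := y * (starRingEnd ℂ) u with hq
  have hqn : ‖q‖ = ‖y‖ := norm_mul_conj_eq hu
  -- what the non-vanishing of the weight says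
  have hnv : 2 * R ^ 2 < ‖y‖ ^ 2 ∧ ‖y‖ ^ 2 < 8 * R ^ 2 ∧ -(1 / 2) < Real.cos (24 * angA u y) := by
    by_contra hcon
    refine hy (wt_eq_zero hR u ?_)
    rw [not_and_or, not_and_or, not_lt, not_lt, not_lt] at hcon
    rcases hcon with h | h | h
    · exact Or.inl h
    · exact Or.inr (Or.inl h)
    · exact Or.inr (Or.inr h)
  obtain ⟨hn1, hn2, hcos⟩ := hnv
  rw [angA_eq_arg, ← hq] at hcos
  have harg : |Complex.arg q| < π / 36 := abs_lt_of_cos24 (abs_arg_lt_of_cone hre him).le hcos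
  obtain ⟨hc, hs⟩ := cos_sin_small harg
  -- `Re q ≥ 0.99 ‖y‖`, `|Im q| ≤ 0.09 ‖y‖`
  have hre' : 99 / 100 * ‖y‖ ≤ q.re := by
    have h0 := Complex.norm_mul_cos_arg q
    calc 99 / 100 * ‖y‖ = ‖y‖ * (99 / 100) := by ring
      _ ≤ ‖y‖ * Real.cos (Complex.arg q) := mul_le_mul_of_nonneg_left hc (norm_nonneg y)
      _ = q.re := by rw [← hqn]; exact h0
  have him' : |q.im| ≤ 9 / 100 * ‖y‖ := by
    have h0 := Complex.norm_mul_sin_arg q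
    calc |q.im| = ‖y‖ * |Real.sin (Complex.arg q)| := by rw [← h0, abs_mul, abs_norm, hqn]
      _ ≤ ‖y‖ * (9 / 100) := mul_le_mul_of_nonneg_left hs (norm_nonneg y)
      _ = 9 / 100 * ‖y‖ := by ring
  have hreq : q.re ≤ ‖y‖ := (Complex.re_le_norm q).trans (le_of_eq hqn)
  -- `1.41 R < ‖y‖ < 2.83 R`
  have hy0 : 0 ≤ ‖y‖ := norm_nonneg _
  have hyl : 141 / 100 * R < ‖y‖ := by nlinarith
  have hyu : ‖y‖ < 283 / 100 * R := by nlinarith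
  refine ⟨⟨by linarith, by linarith, ?_⟩, fun δ hδ h50 => ?_⟩
  · show |q.im| ≤ 1 / 9 * q.re
    linarith
  · intro y' hy'
    rw [mem_ball, dist_eq_norm] at hy'
    set q' := y' * (starRingEnd ℂ) u with hq'
    have hdq : ‖q' - q‖ < δ := by
      rw [hq', hq, ← sub_mul, norm_mul_conj_eq hu]; exact hy'
    have h1 : |(q' - q).re| < δ := lt_of_le_of_lt (Complex.abs_re_le_norm _) hdq
    have h2 : |(q' - q).im| < δ := lt_of_le_of_lt (Complex.abs_im_le_norm _) hdq
    rw [Complex.sub_re, abs_lt] at h1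
    rw [Complex.sub_im, abs_lt] at h2
    rw [abs_le] at him'
    refine ⟨?_, ?_, ?_⟩
    · show R ≤ q'.re; linarith
    · show q'.re ≤ 4 * R; linarith
    · show |q'.im| ≤ 1 / 9 * q'.re
      rw [abs_le]; constructor <;> nlinarith

/-- **Proximity.**  A point `y` with `φ(y) ≠ 0` within distance `δ ≤ R/100` of `T` lies in `T`. [folklore] -/
theorem mem_pieceT_of_near {z y : ℂ} (hz : z ∈ pieceT u R) {δ : ℝ} (hyz : ‖y - z‖ < δ) (hδ : 100 * δ ≤ R)
    (hy : wt x R u y ≠ 0) : y ∈ pieceT u R := by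
  set qz := z * (starRingEnd ℂ) u with hqz
  set q := y * (starRingEnd ℂ) u with hq
  obtain ⟨hz1, hz2, hz3⟩ := hz
  change R ≤ qz.re at hz1; change qz.re ≤ 4 * R at hz2; change |qz.im| ≤ 1 / 9 * qz.re at hz3
  have hdq : ‖q - qz‖ < δ := by
    rw [hq, hqz, ← sub_mul, norm_mul_conj_eq hu]; exact hyz
  have h1 : |(q - qz).re| < δ := lt_of_le_of_lt (Complex.abs_re_le_norm _) hdq
  have h2 : |(q - qz).im| < δ := lt_of_le_of_lt (Complex.abs_im_le_norm _) hdq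
  rw [Complex.sub_re, abs_lt] at h1
  rw [Complex.sub_im, abs_lt] at h2
  rw [abs_le] at hz3
  have hre : 0 < q.re := by linarith
  have him : |q.im| ≤ 1 / 8 * q.re := by
    rw [abs_le]; constructor <;> nlinarith
  exact (deep_of_wt_ne_zero hu hR hy hre him).1

/-- **The piece weight**: the smooth weight cut off by the indicator of `T`. [folklore] -/
def pwt (x R : ℝ) (u z : ℂ) : ℝ := if z ∈ pieceT u R then wt x R u z else 0

omit hu hR in
/-- On `T` the piece weight is the smooth weight. [folklore] -/
theorem pwt_eq_of_mem {z : ℂ} (hz : z ∈ pieceT u R) : pwt x R u z = wt x R u z := if_pos hz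

omit hu hR in
/-- Off `T` the piece weight vanishes. [folklore] -/
theorem pwt_eq_zero_of_not_mem {z : ℂ} (hz : z ∉ pieceT u R) : pwt x R u z = 0 := if_neg hz

/-- Within distance `δ ≤ R/100` of `T` the piece weight is the smooth weight. [folklore] -/
theorem pwt_eq_wt_of_near {z y : ℂ} (hz : z ∈ pieceT u R) {δ : ℝ} (hyz : ‖y - z‖ < δ) (hδ : 100 * δ ≤ R) :
    pwt x R u y = wt x R u y := by
  by_cases hyT : y ∈ pieceT u R
  · exact if_pos hyT
  · rw [pwt, if_neg hyT]
    by_contra h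
    exact hyT (mem_pieceT_of_near hu hR hz hyz hδ (Ne.symm h))

/-- The piece weight agrees with the smooth weight near every point of `T`. [folklore] -/
theorem pwt_eventuallyEq {z : ℂ} (hz : z ∈ pieceT u R) : pwt x R u =ᶠ[nhds z] wt x R u := by
  filter_upwards [Metric.ball_mem_nhds z (by positivity : (0 : ℝ) < R / 100)] with y hy
  rw [mem_ball, dist_eq_norm] at hy
  exact pwt_eq_wt_of_near hu hR hz hy (by linarith)

/-- `|φ| ≤ 4/R` on `T` (for `R² ≤ x`). [folklore] -/
theorem abs_pwt_le (hx : R ^ 2 ≤ x) {z : ℂ} (hz : z ∈ pieceT u R) : |pwt x R u z| ≤ 4 / R := by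
  rw [pwt_eq_of_mem hz]; exact (wt_bounds hR hx u 1 (pieceT_subset_wtDom hu hR hz)).1

/-- The piece weight is Lipschitz on `T`: `|φ(z) - φ(z')| ≤ 372 C_S ‖z - z'‖/R²`. [folklore] -/
theorem pwt_lipschitz (hx : R ^ 2 ≤ x) {z z' : ℂ} (hz : z ∈ pieceT u R) (hz' : z' ∈ pieceT u R) :
    |pwt x R u z - pwt x R u z'| ≤ 372 * stepC / R ^ 2 * ‖z - z'‖ := by
  rw [pwt_eq_of_mem hz, pwt_eq_of_mem hz']
  exact wt_lipschitz hR hx u (convex_trap u R (4 * R) (1 / 9)) (pieceT_subset_wtDom hu hR) hz hz'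

omit hu in
/-- A ball inside `T` bounds the distance to the complement from below. [folklore] -/
theorem le_infDist_of_ball_subset {y : ℂ} {δ : ℝ} (h : ball y δ ⊆ pieceT u R) : δ ≤ infDist y (pieceT u R)ᶜ := by
  have hne : ((pieceT u R)ᶜ).Nonempty := compl_trap_nonempty hR
  rw [Metric.le_infDist hne]
  intro w hw
  by_contra hlt
  push Not at hlt
  exact hw (h (by rw [mem_ball, dist_comm]; exact hlt))

/-- **The piece weight vanishes near the boundary of `T`**: `φ(y) = 0` whenever `infDist(y, Tᶜ) < δ₀`,
provided `50δ₀ ≤ R`. [folklore] -/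
theorem pwt_eq_zero_of_infDist {δ₀ : ℝ} (hδ₀ : 0 < δ₀) (h50 : 50 * δ₀ ≤ R) {y : ℂ}
    (hy : infDist y (pieceT u R)ᶜ < δ₀) : pwt x R u y = 0 := by
  by_cases hyT : y ∈ pieceT u R
  swap
  · exact if_neg hyT
  rw [pwt, if_pos hyT]
  by_contra hne
  have hre : 0 < (y * (starRingEnd ℂ) u).re := hR.trans_le hyT.1
  have him : |(y * (starRingEnd ℂ) u).im| ≤ 1 / 8 * (y * (starRingEnd ℂ) u).re := by
    have := hyT.2.2; have h0 := hyT.1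
    exact this.trans (by nlinarith)
  have hball := (deep_of_wt_ne_zero hu hR hne hre him).2 δ₀ hδ₀ h50
  have := le_infDist_of_ball_subset hR hball
  linarith

/-- **Line-derivatives of the piece weight** at points of `T`: those of the smooth weight. [folklore] -/
theorem pwt_hasDerivAt (hx : R ^ 2 ≤ x) (d e : ℂ) (c a : ℝ) (ha : (a : ℂ) * d + (c : ℂ) * e ∈ pieceT u R) :
    HasDerivAt (fun a : ℝ => pwt x R u ((a : ℂ) * d + (c : ℂ) * e)) (wt₁ x R u d ((a : ℂ) * d + (c : ℂ) * e)) a := by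
  have h := (wt_hasDerivAt hR hx u d e c a (pieceT_subset_wtDom hu hR ha)).1
  refine h.congr_of_eventuallyEq ?_
  have hev := pwt_eventuallyEq hu hR (x := x) ha
  have hcont : ContinuousAt (fun a : ℝ => (a : ℂ) * d + (c : ℂ) * e) a := by fun_prop
  exact hcont.eventually hev |>.mono fun y hy => hy

/-! ### The differenced piece weight -/

/-- `φ_h(z) = φ(z + h) φ(z)`. [folklore] -/
def pwtH (x R : ℝ) (u h z : ℂ) : ℝ := pwt x R u (z + h) * pwt x R u z

/-- For `‖h‖ ≤ R/200` the differenced piece weight agrees with `wtH` within distance `R/300` of `T`. [folklore] -/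
theorem pwtH_eq_wtH_of_near {h : ℂ} (hh : ‖h‖ ≤ R / 200) {z y : ℂ} (hz : z ∈ pieceT u R) (hyz : ‖y - z‖ < R / 300) :
    pwtH x R u h y = wtH x R u h y := by
  rw [pwtH, wtH, pwt_eq_wt_of_near hu hR hz hyz (by linarith), pwt_eq_wt_of_near hu hR hz (δ := R / 100) ?_ (by linarith)]
  · calc ‖y + h - z‖ = ‖(y - z) + h‖ := by ring_nf
      _ ≤ ‖y - z‖ + ‖h‖ := norm_add_le _ _
      _ < R / 100 := by linarith

/-- On `T`: `φ_h = wtH`. [folklore] -/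
theorem pwtH_eq_of_mem {h : ℂ} (hh : ‖h‖ ≤ R / 200) {z : ℂ} (hz : z ∈ pieceT u R) : pwtH x R u h z = wtH x R u h z :=
  pwtH_eq_wtH_of_near hu hR hh hz (by simp; positivity)

/-- `φ_h` agrees with `wtH` near every point of `T`. [folklore] -/
theorem pwtH_eventuallyEq {h : ℂ} (hh : ‖h‖ ≤ R / 200) {z : ℂ} (hz : z ∈ pieceT u R) :
    pwtH x R u h =ᶠ[nhds z] wtH x R u h := by
  filter_upwards [Metric.ball_mem_nhds z (by positivity : (0 : ℝ) < R / 300)] with y hy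
  rw [mem_ball, dist_eq_norm] at hy
  exact pwtH_eq_wtH_of_near hu hR hh hz hy

/-- `|φ_h| ≤ 16/R²` on `T`. [folklore] -/
theorem abs_pwtH_le (hx : R ^ 2 ≤ x) {h : ℂ} (hh : ‖h‖ ≤ R / 200) {z : ℂ} (hz : z ∈ pieceT u R) :
    |pwtH x R u h z| ≤ 16 / R ^ 2 := by
  rw [pwtH_eq_of_mem hu hR hh hz, wtH, abs_mul]
  have h1 := (wt_bounds hR hx u 1 (add_mem_wtDom hu hR (h := h) hz (by linarith))).1
  have h2 := (wt_bounds hR hx u 1 (pieceT_subset_wtDom hu hR hz)).1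
  calc |wt x R u (z + h)| * |wt x R u z| ≤ 4 / R * (4 / R) := mul_le_mul h1 h2 (abs_nonneg _) (by positivity)
    _ = 16 / R ^ 2 := by ring

/-- `φ_h` is Lipschitz on `T`: `|φ_h(z) - φ_h(z')| ≤ 2976 C_S ‖z - z'‖/R³`. [folklore] -/
theorem pwtH_lipschitz (hx : R ^ 2 ≤ x) {h : ℂ} (hh : ‖h‖ ≤ R / 200) {z z' : ℂ} (hz : z ∈ pieceT u R)
    (hz' : z' ∈ pieceT u R) : |pwtH x R u h z - pwtH x R u h z'| ≤ 2976 * stepC / R ^ 3 * ‖z - z'‖ := by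
  rw [pwtH_eq_of_mem hu hR hh hz, pwtH_eq_of_mem hu hR hh hz']
  exact wtH_lipschitz hR hx u h (convex_trap u R (4 * R) (1 / 9)) (pieceT_subset_wtDom hu hR)
    (fun w hw => add_mem_wtDom hu hR hw (by linarith)) hz hz'

/-- `φ_h` vanishes near the boundary of `T` (`50δ₀ ≤ R`). [folklore] -/
theorem pwtH_eq_zero_of_infDist {δ₀ : ℝ} (hδ₀ : 0 < δ₀) (h50 : 50 * δ₀ ≤ R) (h : ℂ) {y : ℂ}
    (hy : infDist y (pieceT u R)ᶜ < δ₀) : pwtH x R u h y = 0 := by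
  rw [pwtH, pwt_eq_zero_of_infDist hu hR hδ₀ h50 hy, mul_zero]

/-- Line-derivatives of `φ_h` at points of `T`. [folklore] -/
theorem pwtH_hasDerivAt (hx : R ^ 2 ≤ x) {h : ℂ} (hh : ‖h‖ ≤ R / 200) (d e : ℂ) (c a : ℝ)
    (ha : (a : ℂ) * d + (c : ℂ) * e ∈ pieceT u R) :
    HasDerivAt (fun a : ℝ => pwtH x R u h ((a : ℂ) * d + (c : ℂ) * e)) (wtH₁ x R u h d ((a : ℂ) * d + (c : ℂ) * e)) a ∧
    HasDerivAt (fun a : ℝ => wtH₁ x R u h d ((a : ℂ) * d + (c : ℂ) * e)) (wtH₂ x R u h d ((a : ℂ) * d + (c : ℂ) * e)) a := by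
  have hmem : a ∈ {a : ℝ | (a : ℂ) * d + (c : ℂ) * e ∈ wtDom u R ∧ (a : ℂ) * d + (c : ℂ) * e + h ∈ wtDom u R} :=
    ⟨pieceT_subset_wtDom hu hR ha, add_mem_wtDom hu hR ha (by linarith)⟩
  have H := c2_wtH_line hR hx u h d ((c : ℂ) * e)
  refine ⟨(H.d1 a hmem).congr_of_eventuallyEq ?_, H.d2 a hmem⟩
  have hev := pwtH_eventuallyEq hu hR (x := x) hh ha
  have hcont : ContinuousAt (fun a : ℝ => (a : ℂ) * d + (c : ℂ) * e) a := by fun_prop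
  exact hcont.eventually hev |>.mono fun y hy => hy

end PieceGeom


/-! ### The lattice directions -/

/-- The companion direction `e` making `(d, e)` a basis of `ℤ[i]`: `(1,i), (i,1), (1+i,1), (1-i,1)`. [folklore] -/
def dirE (k : Fin 4) : ℂ := ![Complex.I, 1, 1, 1] k

/-- Sizes: `1 ≤ ‖dir k‖`, `‖dir k‖² ≤ 2`, `‖dirE k‖ = 1`, `Im(dir k · conj(dirE k))² = 1`, `‖dirSq k‖ = ‖dir k‖²`,
`dir k ≠ 0`. [folklore] -/
theorem dir_facts (k : Fin 4) :
    1 ≤ ‖dir k‖ ∧ ‖dir k‖ ^ 2 ≤ 2 ∧ ‖dirE k‖ = 1 ∧ ((dir k * (starRingEnd ℂ) (dirE k)).im) ^ 2 = 1 ∧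
      ‖dirSq k‖ = ‖dir k‖ ^ 2 ∧ dir k ≠ 0 := by
  have hsq : ‖dirSq k‖ = ‖dir k‖ ^ 2 := by rw [← dir_sq, norm_pow]
  have h12 : ‖(1 : ℂ) + Complex.I‖ ^ 2 = 2 := by
    rw [Complex.sq_norm, Complex.normSq_apply]; simp; norm_num
  have h12' : ‖(1 : ℂ) - Complex.I‖ ^ 2 = 2 := by
    rw [Complex.sq_norm, Complex.normSq_apply]; simp; norm_num
  refine ⟨?_, ?_, ?_, ?_, hsq, ?_⟩
  · fin_cases k
    · simp [dir]
    · simp [dir]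
    · show 1 ≤ ‖(1 : ℂ) + Complex.I‖
      nlinarith [norm_nonneg ((1 : ℂ) + Complex.I)]
    · show 1 ≤ ‖(1 : ℂ) - Complex.I‖
      nlinarith [norm_nonneg ((1 : ℂ) - Complex.I)]
  · fin_cases k
    · simp [dir]
    · simp [dir]
    · exact le_of_eq h12
    · exact le_of_eq h12'
  · fin_cases k <;> simp [dirE]
  · fin_cases k <;> simp [dir, dirE]
  · intro h
    have := (dir_facts_aux k)
    exact this h
  where
  /-- `dir k ≠ 0`. [folklore] -/
  dir_facts_aux (k : Fin 4) : dir k ≠ 0 := by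
    fin_cases k
    · simp [dir]
    · simp [dir]
    · show (1 : ℂ) + Complex.I ≠ 0
      intro h; have := congrArg Complex.re h; simp at this
    · show (1 : ℂ) - Complex.I ≠ 0
      intro h; have := congrArg Complex.re h; simp at this

/-! ### Points of the trapezoid in polar form -/

section Polar

variable {u : ℂ} {R : ℝ} (hu : ‖u‖ = 1) (hR : 0 < R)
include hu hR

/-- For `z ∈ T`, with `q = z ū` and `a = arg q`: `z ≠ 0`, `‖q‖ = ‖z‖`, `|a| < π/24`, `z = u q` and
`z⁻¹ = ū ‖z‖⁻¹ e^{-ia}`. [folklore] -/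
theorem polar_of_mem_pieceT {z : ℂ} (hz : z ∈ pieceT u R) :
    z ≠ 0 ∧ ‖z * (starRingEnd ℂ) u‖ = ‖z‖ ∧ |Complex.arg (z * (starRingEnd ℂ) u)| < π / 24 ∧
      z = u * (z * (starRingEnd ℂ) u) ∧
      z⁻¹ = (starRingEnd ℂ) u * ((‖z‖⁻¹ : ℝ) : ℂ) *
        Complex.exp (-(Complex.arg (z * (starRingEnd ℂ) u) : ℂ) * Complex.I) := by
  set q := z * (starRingEnd ℂ) u with hq
  have hz0 : z ≠ 0 := ne_zero_of_mem_trap hu hR hz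
  have hqn : ‖q‖ = ‖z‖ := norm_mul_conj_eq hu
  have hre : 0 < q.re := hR.trans_le hz.1
  have him : |q.im| ≤ 1 / 8 * q.re := hz.2.2.trans (by nlinarith)
  have harg := abs_arg_lt_of_cone hre him
  have huu : u * (starRingEnd ℂ) u = 1 := by
    rw [Complex.mul_conj, Complex.normSq_eq_norm_sq, hu]; simp
  have hzq : z = u * q := by
    rw [hq, show u * (z * (starRingEnd ℂ) u) = z * (u * (starRingEnd ℂ) u) by ring, huu, mul_one]
  have hzn : 0 < ‖z‖ := norm_pos_iff.2 hz0
  -- `conj q = ‖q‖ e^{-ia}`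
  have hconj : (starRingEnd ℂ) q = (‖q‖ : ℂ) * Complex.exp (-(Complex.arg q : ℂ) * Complex.I) := by
    conv_lhs => rw [← Complex.norm_mul_exp_arg_mul_I q]
    rw [map_mul, Complex.conj_ofReal, ← Complex.exp_conj, map_mul, Complex.conj_ofReal, Complex.conj_I]
    ring_nf
  have hinv : z⁻¹ = (starRingEnd ℂ) u * ((‖z‖⁻¹ : ℝ) : ℂ) * Complex.exp (-(Complex.arg q : ℂ) * Complex.I) := by
    conv_lhs => rw [hzq, mul_inv, Complex.inv_eq_conj hu, Complex.inv_def, hconj, Complex.normSq_eq_norm_sq, hqn]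
    have : (‖z‖ : ℂ) ≠ 0 := by exact_mod_cast hzn.ne'
    push_cast
    field_simp
  exact ⟨hz0, hqn, harg, hzq, hinv⟩

end Polar

/-! ### The direction condition for the logarithmic phase -/

section Plain

variable {w u : ℂ} {R : ℝ} (hu : ‖u‖ = 1) (hR : 0 < R)
include hu hR

/-- **The second derivative along the lines is positive for a suitable direction**: there is `k` with
`Im(G₂(z) (dir k)²) ≥ (3/8) (‖w‖/2π) ‖dir k‖²/‖z‖²` on `T`. [folklore] -/
theorem exists_dir_logPhase (w : ℂ) : ∃ k : Fin 4, ∀ z ∈ pieceT u R,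
    (3 / 8 : ℝ) * (‖w‖ / (2 * π)) * ‖dir k‖ ^ 2 / ‖z‖ ^ 2 ≤ (logPhase₂ w z * dir k ^ 2).im := by
  obtain ⟨k, hk⟩ := exists_direction (w * (starRingEnd ℂ) u ^ 2)
  refine ⟨k, fun z hz => ?_⟩
  obtain ⟨hz0, hqn, harg, hzq, hinv⟩ := polar_of_mem_pieceT hu hR hz
  set q := z * (starRingEnd ℂ) u with hq
  set a := Complex.arg q with ha
  have hzn : 0 < ‖z‖ := norm_pos_iff.2 hz0
  have hζ : ‖dirSq k * (w * (starRingEnd ℂ) u ^ 2)‖ = ‖dir k‖ ^ 2 * ‖w‖ := by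
    rw [norm_mul, norm_mul, norm_pow, Complex.norm_conj, hu, one_pow, mul_one, (dir_facts k).2.2.2.2.1]
  -- the identity
  have key : logPhase₂ w z * dir k ^ 2
      = (((-(‖z‖⁻¹ ^ 2 / (2 * π))) : ℝ) : ℂ) *
          (dirSq k * (w * (starRingEnd ℂ) u ^ 2) * Complex.exp (-((2 * a : ℝ) : ℂ) * Complex.I)) := by
    have e1 : z ^ (-2 : ℤ) = (z⁻¹) ^ 2 := by rw [zpow_neg, zpow_ofNat, inv_pow]
    have e5 : Complex.exp (-(a : ℂ) * Complex.I) ^ 2 = Complex.exp (-((2 * a : ℝ) : ℂ) * Complex.I) := by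
      rw [sq, ← Complex.exp_add]; congr 1; push_cast; ring
    rw [logPhase₂, dir_sq, e1, hinv, mul_pow, mul_pow, e5]
    push_cast
    ring
  rw [key, Complex.im_ofReal_mul]
  have hx : |2 * a| ≤ π / 8 := by
    have hπ := Real.pi_pos
    rw [abs_mul, abs_two]; linarith
  have hDL := hk (2 * a) hx
  rw [hζ] at hDL
  -- `-(‖z‖⁻²/2π) · Im(P) = (‖z‖⁻²/2π) · (-Im P)`
  have hc : 0 < ‖z‖⁻¹ ^ 2 / (2 * π) := by positivity
  calc (3 / 8 : ℝ) * (‖w‖ / (2 * π)) * ‖dir k‖ ^ 2 / ‖z‖ ^ 2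
      = (‖z‖⁻¹ ^ 2 / (2 * π)) * ((3 / 8) * (‖dir k‖ ^ 2 * ‖w‖)) := by
        field_simp
    _ ≤ (‖z‖⁻¹ ^ 2 / (2 * π)) *
        (-(dirSq k * (w * (starRingEnd ℂ) u ^ 2) * Complex.exp (-((2 * a : ℝ) : ℂ) * Complex.I)).im) :=
        mul_le_mul_of_nonneg_left hDL hc.le
    _ = -(‖z‖⁻¹ ^ 2 / (2 * π)) *
        (dirSq k * (w * (starRingEnd ℂ) u ^ 2) * Complex.exp (-((2 * a : ℝ) : ℂ) * Complex.I)).im := by ring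

end Plain

/-! ### The direction condition for the differenced phase -/

section Shift

variable {w u : ℂ} {R : ℝ} (hu : ‖u‖ = 1) (hR : 0 < R)
include hu hR

/-- **Positivity of the second derivative of the differenced phase for a suitable direction**: for
`‖h‖ ≤ R/100` there is `k` with `Im(G_h''(z) (dir k)²) ≥ (7/10) (‖w‖/2π) ‖h‖ ‖dir k‖²/‖z‖³` on `T`. [folklore] -/
theorem exists_dir_shiftPhase (w : ℂ) {h : ℂ} (hh : ‖h‖ ≤ R / 100) : ∃ k : Fin 4, ∀ z ∈ pieceT u R,
    (7 / 10 : ℝ) * (‖w‖ / (2 * π)) * ‖h‖ * ‖dir k‖ ^ 2 / ‖z‖ ^ 3 ≤ (shiftPhase₂ w h z * dir k ^ 2).im := by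
  obtain ⟨k, hk⟩ := exists_direction (-(w * h * (starRingEnd ℂ) u ^ 3))
  refine ⟨k, fun z hz => ?_⟩
  obtain ⟨hz0, hqn, harg, hzq, hinv⟩ := polar_of_mem_pieceT hu hR hz
  have hπ := Real.pi_pos
  set q := z * (starRingEnd ℂ) u with hq
  set a := Complex.arg q with ha
  have hzn : 0 < ‖z‖ := norm_pos_iff.2 hz0
  have hRz : R ≤ ‖z‖ := (norm_bounds_of_mem_pieceT hu hR hz).1
  have hhz : ‖h‖ ≤ ‖z‖ / 100 := hh.trans (by linarith)
  obtain ⟨hzh0, hβle, -⟩ := norm_inv_add_bounds hz0 hhz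
  set α := z⁻¹ with hα
  set β := (z + h)⁻¹ with hβ
  have hnd := (dir_facts k)
  -- the identity `shiftPhase₂ = (w/2π) h α β (α + β)` and the decomposition
  have hS : shiftPhase₂ w h z = w / (2 * π) * h * (α * β) * (α + β) := by
    have := zpow_neg_two_sub hz0 hzh0
    simp only [shiftPhase₂, logPhase₂]
    rw [show -(w / (2 * ↑π)) * (z + h) ^ (-2 : ℤ) - -(w / (2 * ↑π)) * z ^ (-2 : ℤ)
        = -(w / (2 * ↑π)) * ((z + h) ^ (-2 : ℤ) - z ^ (-2 : ℤ)) by ring, this]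
    rw [hα, hβ]; ring
  have hβα : β - α = -h * α * β := by
    rw [hα, hβ, inv_sub_inv' hz0 hzh0]; ring
  have hdec : shiftPhase₂ w h z * dir k ^ 2
      = 2 * (w / (2 * π)) * h * α ^ 3 * dirSq k + (w / (2 * π)) * h * (-h * α ^ 2 * β * (β + 2 * α)) * dirSq k := by
    rw [hS, dir_sq]
    linear_combination (w / (2 * π) * h * dirSq k * (α * (β + 2 * α))) * hβα
  -- the main term in polar form
  have hζ : ‖dirSq k * -(w * h * (starRingEnd ℂ) u ^ 3)‖ = ‖dir k‖ ^ 2 * (‖w‖ * ‖h‖) := by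
    rw [norm_mul, norm_neg, norm_mul, norm_mul, norm_pow, Complex.norm_conj, hu, one_pow, mul_one, hnd.2.2.2.2.1]
  have hmain : 2 * (w / (2 * π)) * h * α ^ 3 * dirSq k
      = (((-(2 * ‖z‖⁻¹ ^ 3 / (2 * π)))) : ℝ) *
          (dirSq k * -(w * h * (starRingEnd ℂ) u ^ 3) * Complex.exp (-((3 * a : ℝ) : ℂ) * Complex.I)) := by
    have e5 : Complex.exp (-(a : ℂ) * Complex.I) ^ 3 = Complex.exp (-((3 * a : ℝ) : ℂ) * Complex.I) := by
      rw [pow_succ, sq, ← Complex.exp_add, ← Complex.exp_add]; congr 1; push_cast; ring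
    rw [hinv, mul_pow, mul_pow, e5]
    push_cast
    ring
  set X := ‖w‖ / (2 * π) * ‖h‖ * ‖dir k‖ ^ 2 / ‖z‖ ^ 3 with hX
  have hmain_im : (3 / 4 : ℝ) * X ≤ (2 * (w / (2 * π)) * h * α ^ 3 * dirSq k).im := by
    rw [hmain, Complex.im_ofReal_mul]
    have hx : |3 * a| ≤ π / 8 := by rw [abs_mul, show |(3:ℝ)| = 3 by norm_num]; linarith
    have hDL := hk (3 * a) hx
    rw [hζ] at hDL
    have hc : 0 < 2 * ‖z‖⁻¹ ^ 3 / (2 * π) := by positivity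
    calc (3 / 4 : ℝ) * X
        = (2 * ‖z‖⁻¹ ^ 3 / (2 * π)) * ((3 / 8) * (‖dir k‖ ^ 2 * (‖w‖ * ‖h‖))) := by rw [hX]; field_simp; ring
      _ ≤ (2 * ‖z‖⁻¹ ^ 3 / (2 * π)) *
          (-(dirSq k * -(w * h * (starRingEnd ℂ) u ^ 3) * Complex.exp (-((3 * a : ℝ) : ℂ) * Complex.I)).im) :=
          mul_le_mul_of_nonneg_left hDL hc.le
      _ = -(2 * ‖z‖⁻¹ ^ 3 / (2 * π)) *
          (dirSq k * -(w * h * (starRingEnd ℂ) u ^ 3) * Complex.exp (-((3 * a : ℝ) : ℂ) * Complex.I)).im := by ring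
  -- the error term
  have hαn : ‖α‖ = ‖z‖⁻¹ := by rw [hα, norm_inv]
  have herr : ‖(w / (2 * π)) * h * (-h * α ^ 2 * β * (β + 2 * α)) * dirSq k‖ ≤ (305 / 10000 : ℝ) * X := by
    have h1 : ‖-h * α ^ 2 * β * (β + 2 * α)‖ ≤ ‖h‖ * ‖z‖⁻¹ ^ 2 * (100 / 99 * ‖z‖⁻¹) * (100 / 99 * ‖z‖⁻¹ + 2 * ‖z‖⁻¹) := by
      rw [norm_mul, norm_mul, norm_mul, norm_neg, norm_pow, hαn]
      have h2 : ‖β + 2 * α‖ ≤ 100 / 99 * ‖z‖⁻¹ + 2 * ‖z‖⁻¹ := by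
        refine (norm_add_le _ _).trans (add_le_add hβle ?_)
        rw [norm_mul, Complex.norm_two, hαn]
      gcongr
    rw [norm_mul, norm_mul, norm_mul, norm_coef, hnd.2.2.2.2.1]
    have hw0 : 0 ≤ ‖w‖ / (2 * π) := by positivity
    calc ‖w‖ / (2 * π) * ‖h‖ * ‖-h * α ^ 2 * β * (β + 2 * α)‖ * ‖dir k‖ ^ 2
        ≤ ‖w‖ / (2 * π) * ‖h‖ * (‖h‖ * ‖z‖⁻¹ ^ 2 * (100 / 99 * ‖z‖⁻¹) * (100 / 99 * ‖z‖⁻¹ + 2 * ‖z‖⁻¹)) * ‖dir k‖ ^ 2 := by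
          gcongr
      _ = ‖w‖ / (2 * π) * ‖h‖ * ‖dir k‖ ^ 2 * ‖z‖⁻¹ ^ 3 * (‖h‖ * ‖z‖⁻¹) * (100 / 99 * (100 / 99 + 2)) := by ring
      _ ≤ ‖w‖ / (2 * π) * ‖h‖ * ‖dir k‖ ^ 2 * ‖z‖⁻¹ ^ 3 * (1 / 100) * (100 / 99 * (100 / 99 + 2)) := by
          gcongr
          rw [← div_eq_mul_inv, div_le_iff₀ hzn]; linarith
      _ ≤ (305 / 10000 : ℝ) * X := by
          rw [hX, div_eq_mul_inv _ (‖z‖ ^ 3), ← inv_pow]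
          have : 0 ≤ ‖w‖ / (2 * π) * ‖h‖ * ‖dir k‖ ^ 2 * ‖z‖⁻¹ ^ 3 := by positivity
          nlinarith
  -- combine
  rw [hdec, Complex.add_im]
  have hI : -(‖(w / (2 * π)) * h * (-h * α ^ 2 * β * (β + 2 * α)) * dirSq k‖)
      ≤ ((w / (2 * π)) * h * (-h * α ^ 2 * β * (β + 2 * α)) * dirSq k).im := by
    have := Complex.abs_im_le_norm ((w / (2 * π)) * h * (-h * α ^ 2 * β * (β + 2 * α)) * dirSq k)
    rw [abs_le] at this; exact this.1
  have h0 : 0 ≤ X := by positivity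
  have hgoal : (7 / 10 : ℝ) * (‖w‖ / (2 * π)) * ‖h‖ * ‖dir k‖ ^ 2 / ‖z‖ ^ 3 = 7 / 10 * X := by rw [hX]; ring
  rw [hgoal]
  linarith [hmain_im, herr, hI, h0]

end Shift

/-! ### Arithmetic of the constants -/

section Arith

/-- The smallness conditions for the undifferenced pieces (`R ≥ 10¹⁰`). [folklore] -/
theorem plain_small {W R nd ne : ℝ} (hW : 0 < W) (hR : (10 : ℝ) ^ 10 ≤ R) (hnd1 : 1 ≤ nd) (hnd2 : nd ^ 2 ≤ 2)
    (hne : ne = 1) :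
    (2 * (W * (R ^ 3)⁻¹) * (max nd ne) ^ 3) *
        ((W * (R ^ 2)⁻¹) * (max nd ne) ^ 2 / (W * (R ^ 2)⁻¹ * nd ^ 2 / 64) + 1) ^ 2
      ≤ (W * (R ^ 2)⁻¹ * nd ^ 2 / 64) / 2 ∧
    4 * ((2 * (W * (R ^ 3)⁻¹) * (max nd ne) ^ 3) *
          ((W * (R ^ 2)⁻¹) * (max nd ne) ^ 2 / (W * (R ^ 2)⁻¹ * nd ^ 2 / 64) + 1) ^ 3
        + (2 * (W * (R ^ 3)⁻¹) * (max nd ne) ^ 3) ^ 2 *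
          ((W * (R ^ 2)⁻¹) * (max nd ne) ^ 2 / (W * (R ^ 2)⁻¹ * nd ^ 2 / 64) + 1) ^ 4
          / (2 * (W * (R ^ 2)⁻¹ * nd ^ 2 / 64)))
      ≤ (W * (((1 + 1 / 9) * (4 * R)) ^ 2)⁻¹) ^ 2 * 1 / ((W * (R ^ 2)⁻¹) * nd ^ 2) ∧
    2 * (ne + ((W * (R ^ 2)⁻¹) * (max nd ne) ^ 2 / (W * (R ^ 2)⁻¹ * nd ^ 2 / 64) + 2) * nd + 1) ≤ 210 := by
  have hR0 : 0 < R := lt_of_lt_of_le (by norm_num) hR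
  have hnd0 : 0 < nd := by linarith
  have hnd15 : nd ≤ 3 / 2 := by nlinarith
  have hmax : max nd ne = nd := max_eq_left (by rw [hne]; exact hnd1)
  rw [hmax]
  have hratio : (W * (R ^ 2)⁻¹) * nd ^ 2 / (W * (R ^ 2)⁻¹ * nd ^ 2 / 64) = 64 := by
    field_simp
  rw [hratio]
  have hnd4 : nd ^ 4 ≤ 4 := by nlinarith
  have hnd5 : nd ^ 5 ≤ 6 := by nlinarith
  have hnd6 : nd ^ 6 ≤ 8 := by nlinarith
  refine ⟨?_, ?_, ?_⟩
  · -- `8450 W nd³/R³ ≤ W nd²/(128 R²)`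
    have e : (W * (R ^ 2)⁻¹ * nd ^ 2 / 64) / 2 - (2 * (W * (R ^ 3)⁻¹) * nd ^ 3) * ((64 : ℝ) + 1) ^ 2
        = W * nd ^ 2 / R ^ 3 * (R / 128 - 8450 * nd) := by
      field_simp; ring
    have hpos : 0 ≤ W * nd ^ 2 / R ^ 3 * (R / 128 - 8450 * nd) := by
      apply mul_nonneg (by positivity); nlinarith
    linarith
  · have e : (W * (((1 + 1 / 9) * (4 * R)) ^ 2)⁻¹) ^ 2 * 1 / ((W * (R ^ 2)⁻¹) * nd ^ 2)
        - 4 * ((2 * (W * (R ^ 3)⁻¹) * nd ^ 3) * ((64 : ℝ) + 1) ^ 3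
          + (2 * (W * (R ^ 3)⁻¹) * nd ^ 3) ^ 2 * ((64 : ℝ) + 1) ^ 4 / (2 * (W * (R ^ 2)⁻¹ * nd ^ 2 / 64)))
        = W / (nd ^ 2 * R ^ 4) * (6561 / 2560000 * R ^ 2 - 2197000 * nd ^ 5 * R - 9139520000 * nd ^ 6) := by
      field_simp; ring
    have hbr : 0 ≤ 6561 / 2560000 * R ^ 2 - 2197000 * nd ^ 5 * R - 9139520000 * nd ^ 6 := by
      nlinarith [mul_le_mul_of_nonneg_right hnd5 hR0.le]
    have hpos : 0 ≤ W / (nd ^ 2 * R ^ 4) * (6561 / 2560000 * R ^ 2 - 2197000 * nd ^ 5 * R - 9139520000 * nd ^ 6) :=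
      mul_nonneg (by positivity) hbr
    linarith
  · rw [hne]; nlinarith

/-- The direction constant: `W nd²/(64R²) ≤ (3/8) W nd²/‖z‖²` for `‖z‖ ≤ 40R/9`. [folklore] -/
theorem plain_r_le {W R nd nz : ℝ} (hW : 0 ≤ W) (hR : 0 < R) (hz1 : R ≤ nz) (hz2 : nz ≤ 40 * R / 9) :
    W * (R ^ 2)⁻¹ * nd ^ 2 / 64 ≤ 3 / 8 * W * nd ^ 2 / nz ^ 2 := by
  have hnz : 0 < nz := hR.trans_le hz1
  rw [show W * (R ^ 2)⁻¹ * nd ^ 2 / 64 = W * nd ^ 2 / (64 * R ^ 2) by field_simp,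
    show 3 / 8 * W * nd ^ 2 / nz ^ 2 = W * nd ^ 2 / (8 / 3 * nz ^ 2) by field_simp]
  exact div_le_div_of_nonneg_left (by positivity) (by positivity) (by nlinarith)

/-- The smallness conditions for the differenced pieces (`R ≥ 10¹⁵`). [folklore] -/
theorem diff_small {W R nd ne Hn : ℝ} (hW : 0 < W) (hR : (10 : ℝ) ^ 15 ≤ R) (hnd1 : 1 ≤ nd) (hnd2 : nd ^ 2 ≤ 2)
    (hne : ne = 1) (hH : 0 < Hn) :
    (8 * Hn * (W * (R ^ 4)⁻¹) * (max nd ne) ^ 3) *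
        (3 * Hn * (W * (R ^ 3)⁻¹) * (max nd ne) ^ 2 / (3 * Hn * (W * (R ^ 3)⁻¹) * nd ^ 2 / 400) + 1) ^ 2
      ≤ (3 * Hn * (W * (R ^ 3)⁻¹) * nd ^ 2 / 400) / 2 ∧
    4 * ((8 * Hn * (W * (R ^ 4)⁻¹) * (max nd ne) ^ 3) *
          (3 * Hn * (W * (R ^ 3)⁻¹) * (max nd ne) ^ 2 / (3 * Hn * (W * (R ^ 3)⁻¹) * nd ^ 2 / 400) + 1) ^ 3
        + (8 * Hn * (W * (R ^ 4)⁻¹) * (max nd ne) ^ 3) ^ 2 *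
          (3 * Hn * (W * (R ^ 3)⁻¹) * (max nd ne) ^ 2 / (3 * Hn * (W * (R ^ 3)⁻¹) * nd ^ 2 / 400) + 1) ^ 4
          / (2 * (3 * Hn * (W * (R ^ 3)⁻¹) * nd ^ 2 / 400)))
      ≤ (Hn * (W * (((1 + 1 / 9) * (4 * R)) ^ 3)⁻¹)) ^ 2 * 1 / (3 * Hn * (W * (R ^ 3)⁻¹) * nd ^ 2) ∧
    2 * (ne + (3 * Hn * (W * (R ^ 3)⁻¹) * (max nd ne) ^ 2 / (3 * Hn * (W * (R ^ 3)⁻¹) * nd ^ 2 / 400) + 2) * nd + 1)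
      ≤ 1210 := by
  have hR0 : 0 < R := lt_of_lt_of_le (by norm_num) hR
  have hnd0 : 0 < nd := by linarith
  have hnd15 : nd ≤ 3 / 2 := by nlinarith
  have hmax : max nd ne = nd := max_eq_left (by rw [hne]; exact hnd1)
  rw [hmax]
  have hratio : 3 * Hn * (W * (R ^ 3)⁻¹) * nd ^ 2 / (3 * Hn * (W * (R ^ 3)⁻¹) * nd ^ 2 / 400) = 400 := by
    field_simp
  rw [hratio]
  have hnd4 : nd ^ 4 ≤ 4 := by nlinarith
  have hnd5 : nd ^ 5 ≤ 6 := by nlinarith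
  have hnd6 : nd ^ 6 ≤ 8 := by nlinarith
  refine ⟨?_, ?_, ?_⟩
  · have e : (3 * Hn * (W * (R ^ 3)⁻¹) * nd ^ 2 / 400) / 2 - (8 * Hn * (W * (R ^ 4)⁻¹) * nd ^ 3) * ((400 : ℝ) + 1) ^ 2
        = Hn * W * nd ^ 2 / R ^ 4 * (3 / 800 * R - 8 * 160801 * nd) := by
      field_simp; ring
    have hpos : 0 ≤ Hn * W * nd ^ 2 / R ^ 4 * (3 / 800 * R - 8 * 160801 * nd) := by
      apply mul_nonneg (by positivity); nlinarith
    linarith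
  · have e : (Hn * (W * (((1 + 1 / 9) * (4 * R)) ^ 3)⁻¹)) ^ 2 * 1 / (3 * Hn * (W * (R ^ 3)⁻¹) * nd ^ 2)
        - 4 * ((8 * Hn * (W * (R ^ 4)⁻¹) * nd ^ 3) * ((400 : ℝ) + 1) ^ 3
          + (8 * Hn * (W * (R ^ 4)⁻¹) * nd ^ 3) ^ 2 * ((400 : ℝ) + 1) ^ 4
            / (2 * (3 * Hn * (W * (R ^ 3)⁻¹) * nd ^ 2 / 400)))
        = Hn * W / (nd ^ 2 * R ^ 5) *
          (177147 / 4096000000 * R ^ 2 - 2063398432 * nd ^ 5 * R - 51200 / 3 * 401 ^ 4 * nd ^ 6) := by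
      field_simp; ring
    have hbr : 0 ≤ 177147 / 4096000000 * R ^ 2 - 2063398432 * nd ^ 5 * R - 51200 / 3 * 401 ^ 4 * nd ^ 6 := by
      nlinarith [mul_le_mul_of_nonneg_right hnd5 hR0.le]
    have hpos : 0 ≤ Hn * W / (nd ^ 2 * R ^ 5) *
        (177147 / 4096000000 * R ^ 2 - 2063398432 * nd ^ 5 * R - 51200 / 3 * 401 ^ 4 * nd ^ 6) :=
      mul_nonneg (by positivity) hbr
    linarith
  · rw [hne]; nlinarith

/-- The direction constant, differenced: `Λ nd²/400 ≤ 0.7 W Hn nd²/‖z‖³`, `Λ = 3 Hn W/R³`, `‖z‖ ≤ 40R/9`. [folklore] -/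
theorem diff_r_le {W R nd nz Hn : ℝ} (hW : 0 ≤ W) (hR : 0 < R) (hH : 0 ≤ Hn) (hz1 : R ≤ nz) (hz2 : nz ≤ 40 * R / 9) :
    3 * Hn * (W * (R ^ 3)⁻¹) * nd ^ 2 / 400 ≤ 7 / 10 * W * Hn * nd ^ 2 / nz ^ 3 := by
  have hnz : 0 < nz := hR.trans_le hz1
  rw [show 3 * Hn * (W * (R ^ 3)⁻¹) * nd ^ 2 / 400 = W * Hn * nd ^ 2 / (400 / 3 * R ^ 3) by field_simp,
    show 7 / 10 * W * Hn * nd ^ 2 / nz ^ 3 = W * Hn * nd ^ 2 / (10 / 7 * nz ^ 3) by field_simp]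
  refine div_le_div_of_nonneg_left (by positivity) (by positivity) ?_
  have h3 : nz ^ 3 ≤ (40 * R / 9) ^ 3 := pow_le_pow_left₀ hnz.le hz2 3
  have e3 : (40 * R / 9) ^ 3 = 64000 / 729 * R ^ 3 := by ring
  rw [e3] at h3
  nlinarith [pow_pos hR 3]

/-- The scale hypotheses for the undifferenced pieces (`W = ‖w‖/2π`, `nd = ‖d‖`, `C = C_S`, `Λ = W/R²`, `g = 4/R`). [folklore] -/
theorem plain_scale {W R nd C : ℝ} (hW : 0 < W) (hR : 1 ≤ R) (hnd1 : 1 ≤ nd) (hnd2 : nd ^ 2 ≤ 2) (hC : 1 ≤ C) :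
    (W / R ^ 2) / 400 ≤ W * (R ^ 2)⁻¹ * nd ^ 2 / 64 ∧
    (W * (R ^ 2)⁻¹ * nd ^ 2 / (W * (R ^ 2)⁻¹ * nd ^ 2 / 64)) * (W * (R ^ 2)⁻¹ * nd ^ 2 / 64) ≤ 2 * (W / R ^ 2) ∧
    W * (R ^ 2)⁻¹ * nd ^ 2 / (W * (R ^ 2)⁻¹ * nd ^ 2 / 64) ≤ 400 ∧
    2 * (W) * (R ^ 3)⁻¹ * nd ^ 3 ≤ 8 * (W / R ^ 2) / R ∧
    372 * C * nd / R ^ 2 ≤ 300 * C * (4 / R) / R ∧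
    44000 * C ^ 2 * nd ^ 2 / R ^ 3 ≤ 80000 * C ^ 2 * (4 / R) / R ^ 2 ∧
    372 * C / R ^ 2 ≤ 200 * C * (4 / R) / R ∧
    2 * (W * (R ^ 3)⁻¹) * nd ^ 2 ≤ 16 * (W / R ^ 2) / R ∧
    W * (R ^ 1)⁻¹ * nd ≤ 2 * (W / R ^ 2) * R ∧
    (W / R ^ 2) / 150000 ≤ (W * (((1 + 1 / 9) * (4 * R)) ^ 2)⁻¹) ^ 2 * 1 / (W * (R ^ 2)⁻¹ * nd ^ 2) ∧
    (W * (R ^ 2)⁻¹) ^ 2 * 1 / (W * (R ^ 2)⁻¹ * nd ^ 2 / 64) ≤ 400 * (W / R ^ 2) ∧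
    W * (R ^ 2)⁻¹ * (max nd 1) ^ 2 ≤ 2 * (W / R ^ 2) := by
  have hR0 : 0 < R := by linarith
  have hnd0 : 0 < nd := by linarith
  have hnd15 : nd ≤ 3 / 2 := by nlinarith
  have hnd3 : nd ^ 3 ≤ 4 := by nlinarith
  have hmax : max nd 1 = nd := max_eq_left hnd1
  have hWR : 0 < W / R ^ 2 := by positivity
  refine ⟨?_, ?_, ?_, ?_, ?_, ?_, ?_, ?_, ?_, ?_, ?_, ?_⟩
  · rw [show W * (R ^ 2)⁻¹ * nd ^ 2 / 64 = (W / R ^ 2) * (nd ^ 2 / 64) by ring,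
      show W / R ^ 2 / 400 = (W / R ^ 2) * (1 / 400) by ring]
    refine mul_le_mul_of_nonneg_left ?_ hWR.le
    nlinarith
  · rw [show (W * (R ^ 2)⁻¹ * nd ^ 2 / (W * (R ^ 2)⁻¹ * nd ^ 2 / 64)) * (W * (R ^ 2)⁻¹ * nd ^ 2 / 64)
        = (W / R ^ 2) * nd ^ 2 by field_simp]
    nlinarith
  · rw [show W * (R ^ 2)⁻¹ * nd ^ 2 / (W * (R ^ 2)⁻¹ * nd ^ 2 / 64) = 64 by field_simp]; norm_num
  · rw [show 2 * W * (R ^ 3)⁻¹ * nd ^ 3 = (W / R ^ 2 / R) * (2 * nd ^ 3) by field_simp,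
      show 8 * (W / R ^ 2) / R = (W / R ^ 2 / R) * 8 by ring]
    exact mul_le_mul_of_nonneg_left (by linarith) (by positivity)
  · rw [show 300 * C * (4 / R) / R = 1200 * C / R ^ 2 by field_simp; ring]
    exact div_le_div_of_nonneg_right (by nlinarith) (by positivity)
  · rw [show 80000 * C ^ 2 * (4 / R) / R ^ 2 = 320000 * C ^ 2 / R ^ 3 by field_simp; ring]
    exact div_le_div_of_nonneg_right (by nlinarith) (by positivity)
  · rw [show 200 * C * (4 / R) / R = 800 * C / R ^ 2 by field_simp; ring]
    exact div_le_div_of_nonneg_right (by nlinarith) (by positivity)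
  · rw [show 2 * (W * (R ^ 3)⁻¹) * nd ^ 2 = (W / R ^ 2 / R) * (2 * nd ^ 2) by field_simp,
      show 16 * (W / R ^ 2) / R = (W / R ^ 2 / R) * 16 by ring]
    exact mul_le_mul_of_nonneg_left (by linarith) (by positivity)
  · rw [show W * (R ^ 1)⁻¹ * nd = (W / R) * nd by field_simp, show 2 * (W / R ^ 2) * R = (W / R) * 2 by field_simp]
    exact mul_le_mul_of_nonneg_left (by linarith) (by positivity)
  · rw [show (W * (((1 + 1 / 9) * (4 * R)) ^ 2)⁻¹) ^ 2 * 1 / (W * (R ^ 2)⁻¹ * nd ^ 2)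
        = (W / R ^ 2) * (6561 / 2560000 / nd ^ 2) by field_simp; ring]
    rw [div_eq_mul_one_div (W / R ^ 2) 150000]
    refine mul_le_mul_of_nonneg_left ?_ hWR.le
    rw [div_le_div_iff₀ (by norm_num) (by positivity)]; nlinarith
  · rw [show (W * (R ^ 2)⁻¹) ^ 2 * 1 / (W * (R ^ 2)⁻¹ * nd ^ 2 / 64) = (W / R ^ 2) * (64 / nd ^ 2) by field_simp]
    rw [show 400 * (W / R ^ 2) = (W / R ^ 2) * 400 by ring]
    refine mul_le_mul_of_nonneg_left ?_ hWR.le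
    rw [div_le_iff₀ (by positivity)]; nlinarith
  · rw [hmax, show W * (R ^ 2)⁻¹ * nd ^ 2 = (W / R ^ 2) * nd ^ 2 by field_simp]
    nlinarith

/-- The scale hypotheses for the differenced pieces (`Λ = 3 H_n W/R³`, `g = 16/R²`, `H_n = ‖h‖`). [folklore] -/
theorem diff_scale {W R nd C Hn : ℝ} (hW : 0 < W) (hR : 1 ≤ R) (hnd1 : 1 ≤ nd) (hnd2 : nd ^ 2 ≤ 2) (hC : 1 ≤ C)
    (hH : 0 < Hn) :
    (3 * Hn * W / R ^ 3) / 400 ≤ 3 * Hn * (W * (R ^ 3)⁻¹) * nd ^ 2 / 400 ∧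
    (3 * Hn * (W * (R ^ 3)⁻¹) * nd ^ 2 / (3 * Hn * (W * (R ^ 3)⁻¹) * nd ^ 2 / 400))
        * (3 * Hn * (W * (R ^ 3)⁻¹) * nd ^ 2 / 400) ≤ 2 * (3 * Hn * W / R ^ 3) ∧
    3 * Hn * (W * (R ^ 3)⁻¹) * nd ^ 2 / (3 * Hn * (W * (R ^ 3)⁻¹) * nd ^ 2 / 400) ≤ 400 ∧
    8 * Hn * (W * (R ^ 4)⁻¹) * nd ^ 3 ≤ 8 * (3 * Hn * W / R ^ 3) / R ∧
    2976 * C * nd / R ^ 3 ≤ 300 * C * (16 / R ^ 2) / R ∧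
    630000 * C ^ 2 * nd ^ 2 / R ^ 4 ≤ 80000 * C ^ 2 * (16 / R ^ 2) / R ^ 2 ∧
    2976 * C / R ^ 3 ≤ 200 * C * (16 / R ^ 2) / R ∧
    8 * Hn * (W * (R ^ 4)⁻¹) * nd ^ 2 ≤ 16 * (3 * Hn * W / R ^ 3) / R ∧
    2 * W * Hn / R ^ 2 * nd ≤ 2 * (3 * Hn * W / R ^ 3) * R ∧
    (3 * Hn * W / R ^ 3) / 150000
      ≤ (Hn * (W * (((1 + 1 / 9) * (4 * R)) ^ 3)⁻¹)) ^ 2 * 1 / (3 * Hn * (W * (R ^ 3)⁻¹) * nd ^ 2) ∧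
    (3 * Hn * (W * (R ^ 3)⁻¹)) ^ 2 * 1 / (3 * Hn * (W * (R ^ 3)⁻¹) * nd ^ 2 / 400) ≤ 400 * (3 * Hn * W / R ^ 3) ∧
    3 * Hn * (W * (R ^ 3)⁻¹) * (max nd 1) ^ 2 ≤ 2 * (3 * Hn * W / R ^ 3) := by
  have hR0 : 0 < R := by linarith
  have hnd0 : 0 < nd := by linarith
  have hnd15 : nd ≤ 3 / 2 := by nlinarith
  have hnd3 : nd ^ 3 ≤ 3 := by nlinarith
  have hmax : max nd 1 = nd := max_eq_left hnd1
  set L := 3 * Hn * W / R ^ 3 with hL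
  have hL0 : 0 < L := by positivity
  have e1 : 3 * Hn * (W * (R ^ 3)⁻¹) * nd ^ 2 / 400 = L * (nd ^ 2 / 400) := by rw [hL]; field_simp
  have e2 : 3 * Hn * (W * (R ^ 3)⁻¹) * nd ^ 2 / (3 * Hn * (W * (R ^ 3)⁻¹) * nd ^ 2 / 400) = 400 := by field_simp
  refine ⟨?_, ?_, ?_, ?_, ?_, ?_, ?_, ?_, ?_, ?_, ?_, ?_⟩
  · rw [e1, show L / 400 = L * (1 / 400) by ring]
    exact mul_le_mul_of_nonneg_left (by nlinarith) hL0.le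
  · rw [e2, e1, show 400 * (L * (nd ^ 2 / 400)) = L * nd ^ 2 by ring]; nlinarith
  · rw [e2]
  · rw [show 8 * Hn * (W * (R ^ 4)⁻¹) * nd ^ 3 = (L / R) * (8 / 3 * nd ^ 3) by rw [hL]; field_simp,
      show 8 * L / R = (L / R) * 8 by ring]
    exact mul_le_mul_of_nonneg_left (by linarith) (by positivity)
  · rw [show 300 * C * (16 / R ^ 2) / R = 4800 * C / R ^ 3 by field_simp; ring]
    exact div_le_div_of_nonneg_right (by nlinarith) (by positivity)
  · rw [show 80000 * C ^ 2 * (16 / R ^ 2) / R ^ 2 = 1280000 * C ^ 2 / R ^ 4 by field_simp; ring]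
    exact div_le_div_of_nonneg_right (by nlinarith) (by positivity)
  · rw [show 200 * C * (16 / R ^ 2) / R = 3200 * C / R ^ 3 by field_simp; ring]
    exact div_le_div_of_nonneg_right (by nlinarith) (by positivity)
  · rw [show 8 * Hn * (W * (R ^ 4)⁻¹) * nd ^ 2 = (L / R) * (8 / 3 * nd ^ 2) by rw [hL]; field_simp,
      show 16 * L / R = (L / R) * 16 by ring]
    exact mul_le_mul_of_nonneg_left (by linarith) (by positivity)
  · rw [show 2 * W * Hn / R ^ 2 * nd = (L * R) * (2 / 3 * nd) by rw [hL]; field_simp,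
      show 2 * L * R = (L * R) * 2 by ring]
    exact mul_le_mul_of_nonneg_left (by linarith) (by positivity)
  · rw [show (Hn * (W * (((1 + 1 / 9) * (4 * R)) ^ 3)⁻¹)) ^ 2 * 1 / (3 * Hn * (W * (R ^ 3)⁻¹) * nd ^ 2)
        = L * (177147 / 4096000000 / 3 / nd ^ 2) by rw [hL]; field_simp; ring]
    rw [show L / 150000 = L * (1 / 150000) by ring]
    refine mul_le_mul_of_nonneg_left ?_ hL0.le
    rw [div_le_div_iff₀ (by norm_num) (by positivity)]; nlinarith
  · rw [show (3 * Hn * (W * (R ^ 3)⁻¹)) ^ 2 * 1 / (3 * Hn * (W * (R ^ 3)⁻¹) * nd ^ 2 / 400) = L * (400 / nd ^ 2) by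
        rw [hL]; field_simp,
      show 400 * L = L * 400 by ring]
    refine mul_le_mul_of_nonneg_left ?_ hL0.le
    rw [div_le_iff₀ (by positivity)]; nlinarith
  · rw [hmax, show 3 * Hn * (W * (R ^ 3)⁻¹) * nd ^ 2 = L * nd ^ 2 by rw [hL]; field_simp]
    nlinarith

end Arith

/-! ### The piece hypotheses and the piece bound for the logarithmic phase -/

section PlainPiece

variable {w u : ℂ} {R x : ℝ} (hu : ‖u‖ = 1) (hw : w ≠ 0) (hR : (10 : ℝ) ^ 10 ≤ R) (hx : R ^ 2 ≤ x)
include hu hw hR hx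

/-- **The piece hypotheses for `F = Im((w/2π) log(z ū))`** on `T = pieceT u R` with the weight `pwt`, for a direction
`dir k` satisfying the direction condition. [folklore] -/
theorem plain_pieceHyp (k : Fin 4)
    (hk : ∀ z ∈ pieceT u R, (3 / 8 : ℝ) * (‖w‖ / (2 * π)) * ‖dir k‖ ^ 2 / ‖z‖ ^ 2 ≤ (logPhase₂ w z * dir k ^ 2).im) :
    PieceHyp (pieceT u R) (dir k) (dirE k)
      (fun z => (logPhase w u z).im) (fun z => (logPhase₁ w z * dir k).im) (fun z => (logPhase₁ w z * dirE k).im)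
      (fun z => (logPhase₂ w z * dir k ^ 2).im) (fun z => (logPhase₂ w z * dir k * dirE k).im)
      (fun z => (logPhase₂ w z * dirE k ^ 2).im) (fun z => (logPhase₃ w z * dir k ^ 3).im)
      (pwt x R u) (wt₁ x R u (dir k)) (wt₂ x R u (dir k))
      (coefB w R 2 * ‖dir k‖ ^ 2 / 64)
      (coefB w R 2 * ‖dir k‖ ^ 2 / (coefB w R 2 * ‖dir k‖ ^ 2 / 64))
      (coefB w R 2 * (max ‖dir k‖ ‖dirE k‖) ^ 2) (2 * coefB w R 3 * (max ‖dir k‖ ‖dirE k‖) ^ 3)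
      (coefB w ((1 + 1 / 9) * (4 * R)) 2 ^ 2 * (dir k * (starRingEnd ℂ) (dirE k)).im ^ 2 / (coefB w R 2 * ‖dir k‖ ^ 2))
      (coefB w R 2 ^ 2 * (dir k * (starRingEnd ℂ) (dirE k)).im ^ 2 / (coefB w R 2 * ‖dir k‖ ^ 2 / 64))
      (2 * coefB w R 3 * ‖dir k‖ ^ 2) (4 / R) (372 * stepC / R ^ 2) 210
      (2 * (‖w‖ / (2 * π)) * (R ^ 3)⁻¹ * ‖dir k‖ ^ 3) (372 * stepC * ‖dir k‖ / R ^ 2)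
      (44000 * stepC ^ 2 * ‖dir k‖ ^ 2 / R ^ 3) (‖w‖ / (2 * π) * (R ^ 1)⁻¹ * ‖dir k‖) := by
  have hR0 : 0 < R := lt_of_lt_of_le (by norm_num) hR
  have hC := one_le_stepC
  obtain ⟨hnd1, hnd2, hne, hq2, hsq, hd0⟩ := dir_facts k
  have hde : (dir k * (starRingEnd ℂ) (dirE k)).im ≠ 0 := by
    intro h; rw [h] at hq2; norm_num at hq2
  have hW : 0 < ‖w‖ / (2 * π) := by have := norm_pos_iff.2 hw; positivity
  have hr : 0 < coefB w R 2 * ‖dir k‖ ^ 2 / 64 := by have := coefB_pos hw hR0 2; positivity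
  have hsm := plain_small (W := ‖w‖ / (2 * π)) (R := R) (nd := ‖dir k‖) (ne := ‖dirE k‖) hW hR hnd1 hnd2 hne
  have H := transverseHyp_logPhase (w := w) (e := dirE k) hu hR0 (by linarith : R ≤ 4 * R) (by norm_num : (0 : ℝ) ≤ 1 / 9)
    hw hd0 hde (φ := pwt x R u) (r := coefB w R 2 * ‖dir k‖ ^ 2 / 64) (G := 4 / R) (Lφ := 372 * stepC / R ^ 2)
    (δ₀ := 210) hr (by positivity) (by positivity)
    (fun z hz => by
      obtain ⟨h1, h2⟩ := norm_bounds_of_mem_pieceT hu hR0 hz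
      exact (plain_r_le (nd := ‖dir k‖) hW.le hR0 h1 h2).trans (hk z hz))
    (by
      have h0 : 0 ≤ coefB w R 2 * ‖dir k‖ ^ 2 := by have := coefB_nonneg w hR0 2; positivity
      rw [div_le_iff₀ (by norm_num : (0 : ℝ) < 64)]; nlinarith)
    (fun z hz => abs_pwt_le hu hR0 hx hz)
    (fun z hz z' hz' => pwt_lipschitz hu hR0 hx hz hz')
    (fun z hz => pwt_eq_zero_of_infDist hu hR0 (by norm_num) (by linarith) hz)
    hsm.2.2
    hsm.1
    (by rw [hq2]; exact hsm.2.1)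
  exact
    { toTransverseHyp := H
      line3 := fun c a ha => (line_chain (w := w) hR0 ha).2.2.1
      cont3 := fun c => continuousOn_line3 (w := w) hR0 c (fun a ha => ha)
      hFddd := fun z hz => (line_bounds (w := w) (e := dirE k) hu hR0 hz).2.1
      hFd := fun z hz => (abs_im_mul_le _ _).trans
        (mul_le_mul_of_nonneg_right (norm_logPhase₁_le hu hR0 hz) (norm_nonneg _))
      lineφ1 := fun c a ha => pwt_hasDerivAt hu hR0 hx (dir k) (dirE k) c a ha
      lineφ2 := fun c a ha => (wt_hasDerivAt hR0 hx u (dir k) (dirE k) c a (pieceT_subset_wtDom hu hR0 ha)).2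
      contφ2 := fun c => wt₂_continuousOn hR0 hx u (dir k) (dirE k) c (fun a ha => pieceT_subset_wtDom hu hR0 ha)
      hφd := fun z hz => (wt_bounds hR0 hx u (dir k) (pieceT_subset_wtDom hu hR0 hz)).2.1
      hφdd := fun z hz => (wt_bounds hR0 hx u (dir k) (pieceT_subset_wtDom hu hR0 hz)).2.2 }

omit hw hx in
/-- The index range of the lines meeting `T` and the lengths of the chords. [folklore] -/
theorem plain_range {k : Fin 4} {T : Set ℂ} {d e : ℂ} {F Fd Fe Fdd Fde Fee : ℂ → ℝ} {φ : ℂ → ℝ}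
    {r A Λ₂ Λ₃ κ₁ κ₂ L₂ G Lφ δ₀ : ℝ} (H : TransverseHyp T d e F Fd Fe Fdd Fde Fee φ r A Λ₂ Λ₃ κ₁ κ₂ L₂ G Lφ δ₀)
    (hT : T = pieceT u R) (hd : d = dir k) (he : e = dirE k) :
    (∀ b : ℤ, (H.chord b).Nonempty → -⌈7 * R⌉ ≤ b ∧ b ≤ ⌈7 * R⌉) ∧
      (∀ b : ℤ, (H.chord b).Nonempty → H.hi b - H.lo b ≤ 9 * R) ∧
      ((⌈7 * R⌉ : ℤ) : ℝ) - ((-⌈7 * R⌉ : ℤ) : ℝ) + 1 ≤ 16 * R := by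
  have hR0 : 0 < R := lt_of_lt_of_le (by norm_num) hR
  obtain ⟨hnd1, hnd2, hne, hq2, hsq, hd0⟩ := dir_facts k
  have hnd15 : ‖dir k‖ ≤ 3 / 2 := by nlinarith
  have hball : T ⊆ closedBall (0 : ℂ) (9 * R / 2) := by rw [hT]; exact pieceT_subset_closedBall hu hR0
  have hq1 : |(e * (starRingEnd ℂ) d).im| = 1 := by
    have : (e * (starRingEnd ℂ) d).im = -(d * (starRingEnd ℂ) e).im := by
      rw [← Complex.conj_conj (e * _), map_mul, Complex.conj_conj, Complex.conj_im, mul_comm]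
    rw [this, abs_neg, hd, he]
    nlinarith [abs_nonneg ((dir k * (starRingEnd ℂ) (dirE k)).im), sq_abs ((dir k * (starRingEnd ℂ) (dirE k)).im)]
  refine ⟨fun b hb => ?_, fun b hb => ?_, ?_⟩
  · have h := H.abs_index_le hball hb
    rw [hq1, mul_one, hd] at h
    have h7 : |(b : ℝ)| ≤ 7 * R := h.trans (by nlinarith)
    rw [abs_le] at h7
    have hc := Int.le_ceil (7 * R)
    constructor
    · have : (-⌈7 * R⌉ : ℝ) ≤ b := by linarith
      exact_mod_cast this
    · have : (b : ℝ) ≤ ⌈7 * R⌉ := by linarith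
      exact_mod_cast this
  · have h := H.hi_sub_lo_le hball hb
    have hdn : ‖d‖ = ‖dir k‖ := by rw [hd]
    rw [hdn] at h
    refine h.trans ?_
    rw [div_le_iff₀ (by linarith)]; nlinarith
  · have hc := Int.ceil_lt_add_one (7 * R)
    push_cast; linarith

/-- **The plain piece bound**: for `R ≥ 10¹⁰`, `R² ≤ x`, `w ≠ 0`, there is a lattice direction `(d, e) = (dir k, dirE k)`
with
`‖∑_{|b| ≤ ⌈7R⌉} ∑_a φ_T(ad + be) e(F(ad+be))‖ ≤ K C_S² (log(1+W) + 4) · 4 · (W/R + W²/R³ + 1 + R/W)`,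
`W = ‖w‖/2π`, `K = pieceK`. [cite: Titchmarsh1935Lattice] [cite: Kaufman1979] -/
theorem norm_plainPiece_le : ∃ k : Fin 4,
    ‖∑ b ∈ Finset.Icc (-⌈7 * R⌉) ⌈7 * R⌉, ∑' a : ℤ,
        (pwt x R u ((a : ℂ) * dir k + (b : ℂ) * dirE k) : ℂ) *
          VdC.e ((logPhase w u ((a : ℂ) * dir k + (b : ℂ) * dirE k)).im)‖
      ≤ pieceK * stepC ^ 2 * (Real.log (1 + ‖w‖ / (2 * π)) + 4) * 4 *
          ((‖w‖ / (2 * π)) / R + (‖w‖ / (2 * π)) ^ 2 / R ^ 3 + 1 + R / (‖w‖ / (2 * π))) := by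
  have hR0 : 0 < R := lt_of_lt_of_le (by norm_num) hR
  have hR1 : 1 ≤ R := le_trans (by norm_num) hR
  have hC := one_le_stepC
  obtain ⟨k, hk⟩ := exists_dir_logPhase hu hR0 w
  obtain ⟨hnd1, hnd2, hne, hq2, hsq, hd0⟩ := dir_facts k
  have hW : 0 < ‖w‖ / (2 * π) := by have := norm_pos_iff.2 hw; positivity
  set W := ‖w‖ / (2 * π) with hWdef
  have P := plain_pieceHyp hu hw hR hx k hk
  obtain ⟨hrange, hchord, hLb⟩ := plain_range hu hR P.H rfl rfl rfl
  have hz₀ : (((2 * R : ℝ) : ℂ) * u) ∈ pieceT u R := by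
    have hq : ((2 * R : ℝ) : ℂ) * u * (starRingEnd ℂ) u = ((2 * R : ℝ) : ℂ) := by
      rw [mul_assoc, Complex.mul_conj, Complex.normSq_eq_norm_sq, hu]; simp
    refine ⟨?_, ?_, ?_⟩ <;> simp only [hq, Complex.ofReal_re, Complex.ofReal_im, abs_zero]
    · linarith
    · linarith
    · positivity
  have hsc := plain_scale (W := W) (C := stepC) hW hR1 hnd1 hnd2 hC
  have h := P.norm_piece_le_scale (neg_le_self (Int.ceil_nonneg (by positivity))) hrange (by positivity) hchord hz₀
    (Λ := W / R ^ 2) (R := R) (g := 4 / R) hR1 (by positivity) le_rfl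
    hsc.1 hsc.2.1 hsc.2.2.1 hsc.2.2.2.1 hsc.2.2.2.2.1 hsc.2.2.2.2.2.1 hsc.2.2.2.2.2.2.1 hsc.2.2.2.2.2.2.2.1
    hsc.2.2.2.2.2.2.2.2.1 (by rw [hq2]; exact hsc.2.2.2.2.2.2.2.2.2.1) (by rw [hq2]; exact hsc.2.2.2.2.2.2.2.2.2.2.1)
    (by rw [hne]; exact hsc.2.2.2.2.2.2.2.2.2.2.2) (by nlinarith) (by rw [hne]; norm_num) le_rfl hLb
  refine ⟨k, h.trans (le_of_eq ?_)⟩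
  have e1 : W / R ^ 2 * R ^ 2 = W := by field_simp
  have e2 : 4 / R * R = 4 := by field_simp
  rw [e1, e2]
  have e3 : W / R ^ 2 * R + (W / R ^ 2) ^ 2 * R + 1 + 1 / (W / R ^ 2 * R) = W / R + W ^ 2 / R ^ 3 + 1 + R / W := by
    field_simp
  rw [e3]

end PlainPiece

/-! ### The piece hypotheses and the piece bound for the differenced phase -/

section DiffPiece

variable {w u h : ℂ} {R x : ℝ} (hu : ‖u‖ = 1) (hw : w ≠ 0) (hR : (10 : ℝ) ^ 15 ≤ R) (hx : R ^ 2 ≤ x)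
  (hh0 : h ≠ 0) (hh : ‖h‖ ≤ R / 200)
include hu hw hR hx hh0 hh

omit hw hx hh0 hh in
/-- `‖G_h'(z)‖ ≤ 2 (‖w‖/2π) ‖h‖/R²` on `T` for `‖h‖ ≤ R/100`. [folklore] -/
theorem norm_shiftPhase₁_le (hh' : ‖h‖ ≤ R / 100) {z : ℂ} (hz : z ∈ pieceT u R) :
    ‖shiftPhase₁ w h z‖ ≤ 2 * (‖w‖ / (2 * π)) * ‖h‖ / R ^ 2 := by
  have hR0 : 0 < R := lt_of_lt_of_le (by norm_num) hR
  obtain ⟨hRz, -⟩ := norm_bounds_of_mem_pieceT hu hR0 hz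
  have hz0 : z ≠ 0 := ne_zero_of_mem_trap hu hR0 hz
  have hzp : 0 < ‖z‖ := norm_pos_iff.2 hz0
  have hhz : ‖h‖ ≤ ‖z‖ / 100 := hh'.trans (by linarith)
  obtain ⟨hzh0, hβle, -⟩ := norm_inv_add_bounds hz0 hhz
  have hid : shiftPhase₁ w h z = w / (2 * π) * (-h * (z⁻¹ * (z + h)⁻¹)) := by
    simp only [shiftPhase₁, logPhase₁, zpow_neg_one]
    rw [show w / (2 * ↑π) * (z + h)⁻¹ - w / (2 * ↑π) * z⁻¹ = w / (2 * ↑π) * ((z + h)⁻¹ - z⁻¹) by ring,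
      inv_sub_inv' hz0 hzh0]
    ring
  rw [hid, norm_mul, norm_coef, norm_mul, norm_neg, norm_mul, norm_inv]
  have hw0 : 0 ≤ ‖w‖ / (2 * π) := by positivity
  calc ‖w‖ / (2 * π) * (‖h‖ * (‖z‖⁻¹ * ‖(z + h)⁻¹‖)) ≤ ‖w‖ / (2 * π) * (‖h‖ * (R⁻¹ * (100 / 99 * R⁻¹))) := by
        refine mul_le_mul_of_nonneg_left (mul_le_mul_of_nonneg_left ?_ (norm_nonneg _)) hw0
        exact mul_le_mul (inv_anti₀ hR0 hRz) (hβle.trans (mul_le_mul_of_nonneg_left (inv_anti₀ hR0 hRz) (by norm_num)))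
          (norm_nonneg _) (by positivity)
    _ ≤ 2 * (‖w‖ / (2 * π)) * ‖h‖ / R ^ 2 := by
        rw [div_eq_mul_inv _ (R ^ 2), ← inv_pow]
        have : 0 ≤ ‖w‖ / (2 * π) * ‖h‖ * R⁻¹ ^ 2 := by positivity
        nlinarith

omit hw hh0 in
/-- Sizes of the line-derivatives of `φ_h` on `T`. [folklore] -/
theorem wtH_bounds' (d : ℂ) {z : ℂ} (hz : z ∈ pieceT u R) :
    |wtH₁ x R u h d z| ≤ 2976 * stepC * ‖d‖ / R ^ 3 ∧ |wtH₂ x R u h d z| ≤ 630000 * stepC ^ 2 * ‖d‖ ^ 2 / R ^ 4 := by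
  have hR0 : 0 < R := lt_of_lt_of_le (by norm_num) hR
  have H := c2_wtH_line hR0 hx u h d z
  have h0 : (0 : ℝ) ∈ {a : ℝ | (a : ℂ) * d + z ∈ wtDom u R ∧ (a : ℂ) * d + z + h ∈ wtDom u R} := by
    refine ⟨?_, ?_⟩ <;> simp only [Complex.ofReal_zero, zero_mul, zero_add]
    · exact pieceT_subset_wtDom hu hR0 hz
    · exact add_mem_wtDom hu hR0 hz (by linarith)
  have e : ((0 : ℝ) : ℂ) * d + z = z := by simp
  exact ⟨by simpa [e] using H.b1 0 h0, by simpa [e] using H.b2 0 h0⟩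

/-- **The piece hypotheses for the differenced phase `F_h = Im(G(z+h) - G(z))`** with the weight `pwtH`. [folklore] -/
theorem diff_pieceHyp (k : Fin 4)
    (hk : ∀ z ∈ pieceT u R, (7 / 10 : ℝ) * (‖w‖ / (2 * π)) * ‖h‖ * ‖dir k‖ ^ 2 / ‖z‖ ^ 3
      ≤ (shiftPhase₂ w h z * dir k ^ 2).im) :
    PieceHyp (pieceT u R) (dir k) (dirE k)
      (fun z => (shiftPhase w u h z).im) (fun z => (shiftPhase₁ w h z * dir k).im)
      (fun z => (shiftPhase₁ w h z * dirE k).im)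
      (fun z => (shiftPhase₂ w h z * dir k ^ 2).im) (fun z => (shiftPhase₂ w h z * dir k * dirE k).im)
      (fun z => (shiftPhase₂ w h z * dirE k ^ 2).im) (fun z => (shiftPhase₃ w h z * dir k ^ 3).im)
      (pwtH x R u h) (wtH₁ x R u h (dir k)) (wtH₂ x R u h (dir k))
      (3 * ‖h‖ * coefB w R 3 * ‖dir k‖ ^ 2 / 400)
      (3 * ‖h‖ * coefB w R 3 * ‖dir k‖ ^ 2 / (3 * ‖h‖ * coefB w R 3 * ‖dir k‖ ^ 2 / 400))
      (3 * ‖h‖ * coefB w R 3 * (max ‖dir k‖ ‖dirE k‖) ^ 2) (8 * ‖h‖ * coefB w R 4 * (max ‖dir k‖ ‖dirE k‖) ^ 3)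
      ((‖h‖ * coefB w ((1 + 1 / 9) * (4 * R)) 3) ^ 2 * (dir k * (starRingEnd ℂ) (dirE k)).im ^ 2
          / (3 * ‖h‖ * coefB w R 3 * ‖dir k‖ ^ 2))
      ((3 * ‖h‖ * coefB w R 3) ^ 2 * (dir k * (starRingEnd ℂ) (dirE k)).im ^ 2
          / (3 * ‖h‖ * coefB w R 3 * ‖dir k‖ ^ 2 / 400))
      (8 * ‖h‖ * coefB w R 4 * ‖dir k‖ ^ 2) (16 / R ^ 2) (2976 * stepC / R ^ 3) 1210
      (8 * ‖h‖ * coefB w R 4 * ‖dir k‖ ^ 3) (2976 * stepC * ‖dir k‖ / R ^ 3)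
      (630000 * stepC ^ 2 * ‖dir k‖ ^ 2 / R ^ 4) (2 * (‖w‖ / (2 * π)) * ‖h‖ / R ^ 2 * ‖dir k‖) := by
  have hR0 : 0 < R := lt_of_lt_of_le (by norm_num) hR
  have hC := one_le_stepC
  obtain ⟨hnd1, hnd2, hne, hq2, hsq, hd0⟩ := dir_facts k
  have hde : (dir k * (starRingEnd ℂ) (dirE k)).im ≠ 0 := by
    intro h; rw [h] at hq2; norm_num at hq2
  have hW : 0 < ‖w‖ / (2 * π) := by have := norm_pos_iff.2 hw; positivity
  have hHn : 0 < ‖h‖ := norm_pos_iff.2 hh0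
  have hh100 : ‖h‖ ≤ R / 100 := hh.trans (by linarith)
  have hh1 : ‖h‖ < R := lt_of_le_of_lt hh (by linarith)
  have hTU := trap_subset_shiftDom (u := u) (ρ₂ := 4 * R) (τ := 1 / 9) hu hR0 hh1
  have hr : 0 < 3 * ‖h‖ * coefB w R 3 * ‖dir k‖ ^ 2 / 400 := by have := coefB_pos hw hR0 3; positivity
  have hsm := diff_small (W := ‖w‖ / (2 * π)) (R := R) (nd := ‖dir k‖) (ne := ‖dirE k‖) (Hn := ‖h‖) hW hR hnd1 hnd2 hne hHn
  have H := transverseHyp_shiftPhase (w := w) (e := dirE k) hu hR0 (by linarith : R ≤ 4 * R)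
    (by norm_num : (0 : ℝ) ≤ 1 / 9) hw hh0 hh100 hd0 hde (φ := pwtH x R u h)
    (r := 3 * ‖h‖ * coefB w R 3 * ‖dir k‖ ^ 2 / 400) (G := 16 / R ^ 2) (Lφ := 2976 * stepC / R ^ 3)
    (δ₀ := 1210) hr (by positivity) (by positivity)
    (fun z hz => by
      obtain ⟨h1, h2⟩ := norm_bounds_of_mem_pieceT hu hR0 hz
      exact (diff_r_le (W := ‖w‖ / (2 * π)) (nd := ‖dir k‖) (Hn := ‖h‖) hW.le hR0 (norm_nonneg h) h1 h2).trans
        (hk z hz))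
    (by
      have h0 : 0 ≤ 3 * ‖h‖ * coefB w R 3 * ‖dir k‖ ^ 2 := by have := coefB_nonneg w hR0 3; positivity
      rw [div_le_iff₀ (by norm_num : (0 : ℝ) < 400)]; nlinarith)
    (fun z hz => abs_pwtH_le hu hR0 hx hh hz)
    (fun z hz z' hz' => pwtH_lipschitz hu hR0 hx hh hz hz')
    (fun z hz => pwtH_eq_zero_of_infDist hu hR0 (by norm_num) (by linarith) h hz)
    hsm.2.2
    hsm.1
    (by rw [hq2]; exact hsm.2.1)
  have HC := shiftPhase_holChain w u h
  exact
    { toTransverseHyp := H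
      line3 := fun c a ha => (hasDerivAt_im_line (dir k ^ 2) (HC.d3 _ (hTU ha))).congr_deriv (by ring_nf)
      cont3 := fun c => HC.continuousOn_line3 c (fun a ha => hTU ha)
      hFddd := fun z hz => (abs_im_mul_le _ _).trans (by
        rw [norm_pow]
        exact mul_le_mul_of_nonneg_right (norm_shiftPhase₃_le hu hR0 hh100 hz) (by positivity))
      hFd := fun z hz => (abs_im_mul_le _ _).trans
        (mul_le_mul_of_nonneg_right (norm_shiftPhase₁_le hu hR hh100 hz) (norm_nonneg _))
      lineφ1 := fun c a ha => (pwtH_hasDerivAt hu hR0 hx hh (dir k) (dirE k) c a ha).1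
      lineφ2 := fun c a ha => (pwtH_hasDerivAt hu hR0 hx hh (dir k) (dirE k) c a ha).2
      contφ2 := fun c => (c2_wtH_line hR0 hx u h (dir k) ((c : ℂ) * dirE k)).cont.mono
        (fun a ha => ⟨pieceT_subset_wtDom hu hR0 ha, add_mem_wtDom hu hR0 ha hh100⟩)
      hφd := fun z hz => (wtH_bounds' hu hR hx hh (dir k) hz).1
      hφdd := fun z hz => (wtH_bounds' hu hR hx hh (dir k) hz).2 }

/-- **The differenced piece bound**: for `R ≥ 10¹⁵`, `R² ≤ x`, `w ≠ 0`, `h ≠ 0`, `‖h‖ ≤ R/200`, there is a lattice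
direction `(dir k, dirE k)` with
`‖∑_b ∑_a φ_h(ad+be) e(F_h(ad+be))‖ ≤ K C_S² (log(1+ΛR²) + 4) (16/R) (ΛR + Λ²R + 1 + 1/(ΛR))`, `Λ = 3‖h‖W/R³`.
[cite: Titchmarsh1935Lattice] [cite: Kaufman1979] -/
theorem norm_diffPiece_le : ∃ k : Fin 4,
    ‖∑ b ∈ Finset.Icc (-⌈7 * R⌉) ⌈7 * R⌉, ∑' a : ℤ,
        (pwtH x R u h ((a : ℂ) * dir k + (b : ℂ) * dirE k) : ℂ) *
          VdC.e ((shiftPhase w u h ((a : ℂ) * dir k + (b : ℂ) * dirE k)).im)‖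
      ≤ pieceK * stepC ^ 2 * (Real.log (1 + 3 * ‖h‖ * (‖w‖ / (2 * π)) / R ^ 3 * R ^ 2) + 4) * (16 / R ^ 2 * R) *
          (3 * ‖h‖ * (‖w‖ / (2 * π)) / R ^ 3 * R + (3 * ‖h‖ * (‖w‖ / (2 * π)) / R ^ 3) ^ 2 * R + 1
            + 1 / (3 * ‖h‖ * (‖w‖ / (2 * π)) / R ^ 3 * R)) := by
  have hR0 : 0 < R := lt_of_lt_of_le (by norm_num) hR
  have hR1 : 1 ≤ R := le_trans (by norm_num) hR
  have hR10 : (10 : ℝ) ^ 10 ≤ R := le_trans (by norm_num) hR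
  have hC := one_le_stepC
  have hHn : 0 < ‖h‖ := norm_pos_iff.2 hh0
  have hh100 : ‖h‖ ≤ R / 100 := hh.trans (by linarith)
  obtain ⟨k, hk⟩ := exists_dir_shiftPhase hu hR0 w hh100
  obtain ⟨hnd1, hnd2, hne, hq2, hsq, hd0⟩ := dir_facts k
  have hW : 0 < ‖w‖ / (2 * π) := by have := norm_pos_iff.2 hw; positivity
  set W := ‖w‖ / (2 * π) with hWdef
  have P := diff_pieceHyp hu hw hR hx hh0 hh k hk
  obtain ⟨hrange, hchord, hLb⟩ := plain_range hu hR10 P.H rfl rfl rfl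
  have hz₀ : (((2 * R : ℝ) : ℂ) * u) ∈ pieceT u R := by
    have hq : ((2 * R : ℝ) : ℂ) * u * (starRingEnd ℂ) u = ((2 * R : ℝ) : ℂ) := by
      rw [mul_assoc, Complex.mul_conj, Complex.normSq_eq_norm_sq, hu]; simp
    refine ⟨?_, ?_, ?_⟩ <;> simp only [hq, Complex.ofReal_re, Complex.ofReal_im, abs_zero]
    · linarith
    · linarith
    · positivity
  have hsc := diff_scale (W := W) (C := stepC) (Hn := ‖h‖) hW hR1 hnd1 hnd2 hC hHn
  have hΛ : 0 < 3 * ‖h‖ * W / R ^ 3 := by positivity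
  have h := P.norm_piece_le_scale (neg_le_self (Int.ceil_nonneg (by positivity))) hrange (by positivity) hchord hz₀
    (Λ := 3 * ‖h‖ * W / R ^ 3) (R := R) (g := 16 / R ^ 2) hR1 hΛ le_rfl
    hsc.1 hsc.2.1 hsc.2.2.1 hsc.2.2.2.1 hsc.2.2.2.2.1 hsc.2.2.2.2.2.1 hsc.2.2.2.2.2.2.1 hsc.2.2.2.2.2.2.2.1
    hsc.2.2.2.2.2.2.2.2.1 (by rw [hq2]; exact hsc.2.2.2.2.2.2.2.2.2.1) (by rw [hq2]; exact hsc.2.2.2.2.2.2.2.2.2.2.1)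
    (by rw [hne]; exact hsc.2.2.2.2.2.2.2.2.2.2.2) (by nlinarith) (by rw [hne]; norm_num) le_rfl hLb
  exact ⟨k, h⟩

end DiffPiece

end VdC
end Literature.NumberTheory.LFunctions

end
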